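import Literature.Analysis.FluidPDE.ElgindiAngularIdentification
import Literature.Analysis.FluidPDE.ElgindiAngularLevelEstimate
import Literature.Analysis.FluidPDE.ElgindiPolarStepThree
import HarnessLib

/-!
# The `𝓗⁴` elliptic a-priori estimate, assembled: all levels `(i, j)`, `1 ≤ i`, `i + j ≤ 4`
([Elgindi2021] §7.3–7.4 Propositions 7.7, 7.9; [ElgindiGhoulMasmoudi2021] §6 Theorem 3, for `k = 4`)

Topic `Literature/Analysis/FluidPDE`. Proof file (everything proved, no definitions, no named
facts) on the proof path of the named fact
`Literature.Analysis.FluidPDE.Elgindi.ElgindiGhoulMasmoudi2021_stabilityCore`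
(`ElgindiStabilityDecomposition.lean`). T. M. Elgindi, T.-E. Ghoul, N. Masmoudi, Camb. J. Math. 9
(2021) = arXiv:1910.14071, §6 (p. 15 of the held text):

> "By induction on `k` we now have the following theorem. **Theorem 3.** Let `k ≥ 2`, `0 < α`
> sufficiently small and assume `F ∈ 𝓗ᵏ` satisfies the above orthogonality condition. Then the unique
> solution to (6.1) satisfies `α²|D_R²Ψ|_{𝓗ᵏ} + α|D_RΨ|_{𝓗ᵏ} + |∂_θθΨ|_{𝓗ᵏ} ≤ C_k|F|_{𝓗ᵏ}`"

and T. M. Elgindi, Ann. of Math. 194 (2021) = arXiv:1904.04795, §7.3 Steps 4–5 / §7.4 (p. 22–23).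
This file carries out the induction for `k = 4` (the order of the stability theorem) in the a-priori
class `Ψ = cos θχ` (`χ ∈ C⁸(ℝ²)` compactly supported inside `R > 0`, `χ(R,0) = 0`, `F = L(Ψ)`
orthogonal to `sin θcos²θ` on every slice), in order of increasing angular level `i = 1, 2, 3, 4` and
for all radial orders `j` with `i + j ≤ 4`: each level quantity
`M_{ij} + N_{ij} = ∫∫ w²(∂_θ^{i+2}D_R^jΨ)²s^{2i−γ} + ∫∫ w²(∂_θ^{i+1}D_R^jχ)²s^{2i−γ}` is bounded by an
explicit multiple of the datum
`D = Σ_{m≤4}∫∫ w²u(D_R^mF)² + Σ_{i,j}∫∫ w²(∂_θ^iD_R^jF)²s^{2i−γ}` (`u = s^{−η}`, `F` through its smooth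
representative `gF`), using `angular_level_estimate`, `angular_data_bound`, Step 3 at all radial
orders (`polar_singular_apriori_estimate_iterate`) and the identifications of
`ElgindiAngularIdentification.lean` (`elliptic_apriori_levels`).
-/

noncomputable section

open MeasureTheory Set Real Filter Function Finset
open _root_.Topology

namespace Literature.Analysis.FluidPDE

namespace Elgindi

/-- Nonnegativity of the standard integrands on the strip. [folklore] -/
theorem strip_integrand_nonneg {p : ℝ × ℝ} (hp : p ∈ strip) (a r : ℝ) :
    0 ≤ radialWeight p.1 ^ 2 * a ^ 2 * Real.sin (2 * p.2) ^ r :=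
  mul_nonneg (mul_nonneg (sq_nonneg _) (sq_nonneg _))
    (Real.rpow_nonneg (Real.sin_pos_of_pos_of_lt_pi (by linarith [hp.2.1]) (by linarith [hp.2.2])).le _)

/-- Nonnegativity of the `Z`-type integrands on the strip. [folklore] -/
theorem strip_integrand_nonneg' {p : ℝ × ℝ} (hp : p ∈ strip) (a r : ℝ) :
    0 ≤ p.1 ^ 2 * radialWeight p.1 ^ 2 * a ^ 2 * Real.sin (2 * p.2) ^ r :=
  mul_nonneg (mul_nonneg (mul_nonneg (sq_nonneg _) (sq_nonneg _)) (sq_nonneg _))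
    (Real.rpow_nonneg (Real.sin_pos_of_pos_of_lt_pi (by linarith [hp.2.1]) (by linarith [hp.2.2])).le _)

/-- `dθ^[1] = dθ`, `dθ^[2] = dθ ∘ dθ` (definitional). [folklore] -/
theorem iterate_dθ_one (f : ℝ → ℝ → ℝ) : dθ^[1] f = dθ f := rfl

/-- `dθ^[2] f = dθ (dθ f)` (definitional). [folklore] -/
theorem iterate_dθ_two (f : ℝ → ℝ → ℝ) : dθ^[2] f = dθ (dθ f) := rfl

set_option linter.unusedSimpArgs false in
set_option linter.unusedTactic false in
set_option linter.unreachableTactic false in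
set_option maxRecDepth 4000 in
set_option maxHeartbeats 4000000 in
/-- **The `𝓗⁴` elliptic a-priori estimate, level by level** (see the module docstring): in the
a-priori class, for `0 < α ≤ 1/4`, every level quantity `M_{ij} + N_{ij}` (`1 ≤ i`, `i + j ≤ 4`) is at
most `7·10²²·D`, where the datum `D` is passed as a named real together with its defining equation
`hD` (instantiate with `rfl`). [cite: ElgindiGhoulMasmoudi2021, §6 Theorem 3 (p. 15 of arXiv:1910.14071)]
[cite: Elgindi2021, §7.3 Proposition 7.7 Steps 3–5 and §7.4 Proposition 7.9 (p. 22–23 of arXiv:1904.04795)] -/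
theorem elliptic_apriori_levels {α : ℝ} (hα : 0 < α) (hα4 : α ≤ 1 / 4) {χ : ℝ → ℝ → ℝ}
    (hχ : ContDiff ℝ 8 (uncurry χ)) (hs : HasCompactSupport (uncurry χ)) (hpos : ∀ p ∈ tsupport (uncurry χ), 0 < p.1)
    (hχ0 : ∀ R, χ R 0 = 0) {Ψ gF : ℝ → ℝ → ℝ} (hΨ : Ψ = fun R θ => Real.cos θ * χ R θ)
    (horth : ∀ R, 0 < R → ∫ θ in Ioo 0 (π / 2), ellipticOp α Ψ R θ * kernelK θ = 0)
    (hgF : gF = fun R θ => -α ^ 2 * R ^ 2 * dz (dz Ψ) R θ - α * (5 + α) * R * dz Ψ R θ -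
      dθ (dθ Ψ) R θ + (Real.cos θ * χ R θ + Real.sin θ * dθ χ R θ) - 6 * Ψ R θ)
    {D : ℝ} (hD : D = ((∫ p in strip, radialWeight p.1 ^ 2 * ellipticOp α Ψ p.1 p.2 ^ 2 * Real.sin (2 * p.2) ^ (-eta)) + (∫ p in strip, radialWeight p.1 ^ 2 * (Dz^[1] (ellipticOp α Ψ)) p.1 p.2 ^ 2 * Real.sin (2 * p.2) ^ (-eta)) + (∫ p in strip, radialWeight p.1 ^ 2 * (Dz^[2] (ellipticOp α Ψ)) p.1 p.2 ^ 2 * Real.sin (2 * p.2) ^ (-eta)) + (∫ p in strip, radialWeight p.1 ^ 2 * (Dz^[3] (ellipticOp α Ψ)) p.1 p.2 ^ 2 * Real.sin (2 * p.2) ^ (-eta)) + (∫ p in strip, radialWeight p.1 ^ 2 * (Dz^[4] (ellipticOp α Ψ)) p.1 p.2 ^ 2 * Real.sin (2 * p.2) ^ (-eta)) +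
        (∫ p in strip, radialWeight p.1 ^ 2 * dθ gF p.1 p.2 ^ 2 * Real.sin (2 * p.2) ^ (2 - gammaExp α)) +
        (∫ p in strip, radialWeight p.1 ^ 2 * dθ (Dz^[1] gF) p.1 p.2 ^ 2 * Real.sin (2 * p.2) ^ (2 - gammaExp α)) +
        (∫ p in strip, radialWeight p.1 ^ 2 * dθ (Dz^[2] gF) p.1 p.2 ^ 2 * Real.sin (2 * p.2) ^ (2 - gammaExp α)) +
        (∫ p in strip, radialWeight p.1 ^ 2 * dθ (Dz^[3] gF) p.1 p.2 ^ 2 * Real.sin (2 * p.2) ^ (2 - gammaExp α)) +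
        (∫ p in strip, radialWeight p.1 ^ 2 * dθ (dθ gF) p.1 p.2 ^ 2 * Real.sin (2 * p.2) ^ (4 - gammaExp α)) +
        (∫ p in strip, radialWeight p.1 ^ 2 * dθ (dθ (Dz^[1] gF)) p.1 p.2 ^ 2 * Real.sin (2 * p.2) ^ (4 - gammaExp α)) +
        (∫ p in strip, radialWeight p.1 ^ 2 * dθ (dθ (Dz^[2] gF)) p.1 p.2 ^ 2 * Real.sin (2 * p.2) ^ (4 - gammaExp α)) +
        (∫ p in strip, radialWeight p.1 ^ 2 * (dθ^[3] gF) p.1 p.2 ^ 2 * Real.sin (2 * p.2) ^ (6 - gammaExp α)) +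
        (∫ p in strip, radialWeight p.1 ^ 2 * (dθ^[3] (Dz^[1] gF)) p.1 p.2 ^ 2 * Real.sin (2 * p.2) ^ (6 - gammaExp α)) +
        (∫ p in strip, radialWeight p.1 ^ 2 * (dθ^[4] gF) p.1 p.2 ^ 2 * Real.sin (2 * p.2) ^ (8 - gammaExp α)))) :
    ((∫ p in strip, radialWeight p.1 ^ 2 * (dθ^[3] Ψ) p.1 p.2 ^ 2 * Real.sin (2 * p.2) ^ (2 - gammaExp α)) +
      (∫ p in strip, radialWeight p.1 ^ 2 * dθ (dθ χ) p.1 p.2 ^ 2 * Real.sin (2 * p.2) ^ (2 - gammaExp α)) ≤ 200000000 * D) ∧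
    ((∫ p in strip, radialWeight p.1 ^ 2 * (dθ^[3] (Dz^[1] Ψ)) p.1 p.2 ^ 2 * Real.sin (2 * p.2) ^ (2 - gammaExp α)) +
      (∫ p in strip, radialWeight p.1 ^ 2 * dθ (dθ (Dz^[1] χ)) p.1 p.2 ^ 2 * Real.sin (2 * p.2) ^ (2 - gammaExp α)) ≤ 200000000 * D) ∧
    ((∫ p in strip, radialWeight p.1 ^ 2 * (dθ^[3] (Dz^[2] Ψ)) p.1 p.2 ^ 2 * Real.sin (2 * p.2) ^ (2 - gammaExp α)) +
      (∫ p in strip, radialWeight p.1 ^ 2 * dθ (dθ (Dz^[2] χ)) p.1 p.2 ^ 2 * Real.sin (2 * p.2) ^ (2 - gammaExp α)) ≤ 200000000 * D) ∧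
    ((∫ p in strip, radialWeight p.1 ^ 2 * (dθ^[3] (Dz^[3] Ψ)) p.1 p.2 ^ 2 * Real.sin (2 * p.2) ^ (2 - gammaExp α)) +
      (∫ p in strip, radialWeight p.1 ^ 2 * dθ (dθ (Dz^[3] χ)) p.1 p.2 ^ 2 * Real.sin (2 * p.2) ^ (2 - gammaExp α)) ≤ 200000000 * D) ∧
    ((∫ p in strip, radialWeight p.1 ^ 2 * (dθ^[4] Ψ) p.1 p.2 ^ 2 * Real.sin (2 * p.2) ^ (4 - gammaExp α)) +
      (∫ p in strip, radialWeight p.1 ^ 2 * (dθ^[3] χ) p.1 p.2 ^ 2 * Real.sin (2 * p.2) ^ (4 - gammaExp α)) ≤ 3000000000000 * D) ∧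
    ((∫ p in strip, radialWeight p.1 ^ 2 * (dθ^[4] (Dz^[1] Ψ)) p.1 p.2 ^ 2 * Real.sin (2 * p.2) ^ (4 - gammaExp α)) +
      (∫ p in strip, radialWeight p.1 ^ 2 * (dθ^[3] (Dz^[1] χ)) p.1 p.2 ^ 2 * Real.sin (2 * p.2) ^ (4 - gammaExp α)) ≤ 3000000000000 * D) ∧
    ((∫ p in strip, radialWeight p.1 ^ 2 * (dθ^[4] (Dz^[2] Ψ)) p.1 p.2 ^ 2 * Real.sin (2 * p.2) ^ (4 - gammaExp α)) +
      (∫ p in strip, radialWeight p.1 ^ 2 * (dθ^[3] (Dz^[2] χ)) p.1 p.2 ^ 2 * Real.sin (2 * p.2) ^ (4 - gammaExp α)) ≤ 3000000000000 * D) ∧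
    ((∫ p in strip, radialWeight p.1 ^ 2 * (dθ^[5] Ψ) p.1 p.2 ^ 2 * Real.sin (2 * p.2) ^ (6 - gammaExp α)) +
      (∫ p in strip, radialWeight p.1 ^ 2 * (dθ^[4] χ) p.1 p.2 ^ 2 * Real.sin (2 * p.2) ^ (6 - gammaExp α)) ≤ 200000000000000000 * D) ∧
    ((∫ p in strip, radialWeight p.1 ^ 2 * (dθ^[5] (Dz^[1] Ψ)) p.1 p.2 ^ 2 * Real.sin (2 * p.2) ^ (6 - gammaExp α)) +
      (∫ p in strip, radialWeight p.1 ^ 2 * (dθ^[4] (Dz^[1] χ)) p.1 p.2 ^ 2 * Real.sin (2 * p.2) ^ (6 - gammaExp α)) ≤ 200000000000000000 * D) ∧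
    ((∫ p in strip, radialWeight p.1 ^ 2 * (dθ^[6] Ψ) p.1 p.2 ^ 2 * Real.sin (2 * p.2) ^ (8 - gammaExp α)) +
      (∫ p in strip, radialWeight p.1 ^ 2 * (dθ^[5] χ) p.1 p.2 ^ 2 * Real.sin (2 * p.2) ^ (8 - gammaExp α)) ≤ 70000000000000000000000 * D) := by
  have hα1 : α ≤ 1 := by linarith
  have hα2 : α ^ 2 ≤ 1 := by nlinarith
  have hα4' : α ^ 4 ≤ 1 := by nlinarith
  have hα20 : 0 ≤ α ^ 2 := by positivity
  have hα40 : 0 ≤ α ^ 4 := by positivity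
  have hγ1 : 1 < gammaExp α := one_lt_gammaExp hα
  have hγ2 : gammaExp α ≤ 41 / 40 := by unfold gammaExp; linarith
  have hWc : ContinuousOn (fun R => radialWeight R ^ 2) (Ioi 0) := (contDiffOn_radialWeight_sq (n := 0)).continuousOn
  have hW0 : ∀ R, 0 < R → 0 ≤ (fun R => radialWeight R ^ 2) R := fun R _ => sq_nonneg _
  have hMc : ContinuousOn (fun R => R ^ 2 * radialWeight R ^ 2) (Ioi 0) := (continuousOn_id.pow 2).mul hWc
  have hM0 : ∀ R, 0 < R → 0 ≤ (fun R => R ^ 2 * radialWeight R ^ 2) R := fun R _ => by positivity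
  -- regularity bookkeeping
  have hΨc : ContDiff ℝ 8 (uncurry Ψ) := by rw [hΨ]; exact contDiff_cosProfile hχ
  have hΨs : HasCompactSupport (uncurry Ψ) := by rw [hΨ]; exact hasCompactSupport_cosProfile hs
  have hΨsub : tsupport (uncurry Ψ) ⊆ tsupport (uncurry χ) := by
    refine tsupport_subset_of_eq_zero (X := uncurry χ) (g := uncurry Ψ) fun p hp => ?_
    show Ψ p.1 p.2 = 0
    rw [hΨ]; simp [show χ p.1 p.2 = 0 from hp]
  have regχ3 : ∀ m, m ≤ 4 → ContDiff ℝ ((3 + m : ℕ) : WithTop ℕ∞) (uncurry χ) := fun m hm =>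
    hχ.of_le (by exact_mod_cast (show 3 + m ≤ 8 by omega))
  have regχd : ∀ i j : ℕ, i + j ≤ 4 → ContDiff ℝ ((i + j + 4 : ℕ) : WithTop ℕ∞) (uncurry χ) := fun i j h =>
    hχ.of_le (by exact_mod_cast (show i + j + 4 ≤ 8 by omega))
  have regχj : ∀ i j : ℕ, i + j ≤ 4 → ContDiff ℝ (i + 2) (uncurry (Dz^[j] χ)) := by
    intro i j h
    have h1 : ContDiff ℝ (((i + 2) + j : ℕ) : WithTop ℕ∞) (uncurry χ) := hχ.of_le (by exact_mod_cast (show i + 2 + j ≤ 8 by omega))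
    have := contDiff_iterate_Dz_of_contDiff (m := j) (n := i + 2) (by exact_mod_cast h1)
    exact_mod_cast this
  have hsj : ∀ j, HasCompactSupport (uncurry (Dz^[j] χ)) := fun j => hasCompactSupport_iterate_Dz hs j
  have hposj : ∀ j, ∀ p ∈ tsupport (uncurry (Dz^[j] χ)), 0 < p.1 := fun j => tsupport_iterate_Dz_pos hpos j
  have hΨj : ∀ j, j ≤ 4 → Dz^[j] Ψ = fun R θ => Real.cos θ * (Dz^[j] χ) R θ := fun j hj => by
    rw [hΨ]; exact iterate_Dz_cosProfile j (hχ.of_le (by exact_mod_cast (show j ≤ 8 by omega)))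
  -- continuity / support of the plane functions `∂^n D_R^m Ψ`, `∂^n D_R^m χ`
  have cΨ : ∀ n m : ℕ, n + m ≤ 8 → Continuous fun p : ℝ × ℝ => (dθ^[n] (Dz^[m] Ψ)) p.1 p.2 := by
    intro n m h
    have h1 : ContDiff ℝ ((n + m : ℕ) : WithTop ℕ∞) (uncurry Ψ) := hΨc.of_le (by exact_mod_cast h)
    have h2 : ContDiff ℝ (n : ℕ) (uncurry (Dz^[m] Ψ)) := contDiff_iterate_Dz_of_contDiff (m := m) (n := n) (by exact_mod_cast h1)
    exact (contDiff_iterate_dθ_of_contDiff (n := n) (m := 0) (by simpa using h2)).continuous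
  have cχ : ∀ n m : ℕ, n + m ≤ 8 → Continuous fun p : ℝ × ℝ => (dθ^[n] (Dz^[m] χ)) p.1 p.2 := by
    intro n m h
    have h1 : ContDiff ℝ ((n + m : ℕ) : WithTop ℕ∞) (uncurry χ) := hχ.of_le (by exact_mod_cast h)
    have h2 : ContDiff ℝ (n : ℕ) (uncurry (Dz^[m] χ)) := contDiff_iterate_Dz_of_contDiff (m := m) (n := n) (by exact_mod_cast h1)
    exact (contDiff_iterate_dθ_of_contDiff (n := n) (m := 0) (by simpa using h2)).continuous
  have sΨ : ∀ n m : ℕ, HasCompactSupport fun p : ℝ × ℝ => (dθ^[n] (Dz^[m] Ψ)) p.1 p.2 := fun n m =>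
    hasCompactSupport_iterate_dθ (hasCompactSupport_iterate_Dz hΨs m) n
  have sχ : ∀ n m : ℕ, HasCompactSupport fun p : ℝ × ℝ => (dθ^[n] (Dz^[m] χ)) p.1 p.2 := fun n m =>
    hasCompactSupport_iterate_dθ (hasCompactSupport_iterate_Dz hs m) n
  have pΨ : ∀ n m : ℕ, ∀ p ∈ tsupport (fun p : ℝ × ℝ => (dθ^[n] (Dz^[m] Ψ)) p.1 p.2), 0 < p.1 := fun n m p hp =>
    hpos p (hΨsub ((tsupport_iterate_Dz_subset m) ((tsupport_iterate_dθ_subset n) hp)))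
  have pχ : ∀ n m : ℕ, ∀ p ∈ tsupport (fun p : ℝ × ℝ => (dθ^[n] (Dz^[m] χ)) p.1 p.2), 0 < p.1 := fun n m p hp =>
    hpos p ((tsupport_iterate_Dz_subset m) ((tsupport_iterate_dθ_subset n) hp))
  -- the mixed function `R ∂_R∂_θ D_R^m Ψ`
  have cZ : ∀ m : ℕ, m ≤ 5 → Continuous fun p : ℝ × ℝ => p.1 * dz (dθ (Dz^[m] Ψ)) p.1 p.2 := by
    intro m hm
    have h1 : ContDiff ℝ ((2 + m : ℕ) : WithTop ℕ∞) (uncurry Ψ) := hΨc.of_le (by exact_mod_cast (show 2 + m ≤ 8 by omega))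
    have h2 : ContDiff ℝ 2 (uncurry (Dz^[m] Ψ)) := by
      have := contDiff_iterate_Dz_of_contDiff (m := m) (n := 2) (by exact_mod_cast h1); exact_mod_cast this
    have h3 : ContDiff ℝ 1 (uncurry (dθ (Dz^[m] Ψ))) := contDiff_dθ_of_contDiff h2
    have h4 : ContDiff ℝ 0 (uncurry (dz (dθ (Dz^[m] Ψ)))) := contDiff_dz_of_contDiff h3
    exact continuous_fst.mul h4.continuous
  have sZ : ∀ m : ℕ, HasCompactSupport fun p : ℝ × ℝ => p.1 * dz (dθ (Dz^[m] Ψ)) p.1 p.2 := fun m =>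
    (hasCompactSupport_dz (hasCompactSupport_dθ_of (hasCompactSupport_iterate_Dz hΨs m))).mul_left
  have pZ : ∀ m : ℕ, ∀ p ∈ tsupport (fun p : ℝ × ℝ => p.1 * dz (dθ (Dz^[m] Ψ)) p.1 p.2), 0 < p.1 := by
    intro m p hp
    refine hpos p (hΨsub ((tsupport_iterate_Dz_subset m) ((tsupport_dθ_subset' _) (tsupport_dz_subset ?_))))
    exact (tsupport_mul_subset_right (f := fun p : ℝ × ℝ => p.1) (g := uncurry (dz (dθ (Dz^[m] Ψ))))) hp
  -- Step 3 at radial orders 0..4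

  obtain ⟨hP0, hZ0, hC0, hR0, hX0, hB0, hY0, hRR0⟩ :=
    polar_singular_apriori_estimate_iterate hα hα4 0 (regχ3 0 (by norm_num)) hs hpos hχ0 hΨ horth
  obtain ⟨hP1, hZ1, hC1, hR1, hX1, hB1, hY1, hRR1⟩ :=
    polar_singular_apriori_estimate_iterate hα hα4 1 (regχ3 1 (by norm_num)) hs hpos hχ0 hΨ horth
  obtain ⟨hP2, hZ2, hC2, hR2, hX2, hB2, hY2, hRR2⟩ :=
    polar_singular_apriori_estimate_iterate hα hα4 2 (regχ3 2 (by norm_num)) hs hpos hχ0 hΨ horth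
  obtain ⟨hP3, hZ3, hC3, hR3, hX3, hB3, hY3, hRR3⟩ :=
    polar_singular_apriori_estimate_iterate hα hα4 3 (regχ3 3 (by norm_num)) hs hpos hχ0 hΨ horth
  obtain ⟨hP4, hZ4, hC4, hR4, hX4, hB4, hY4, hRR4⟩ :=
    polar_singular_apriori_estimate_iterate hα hα4 4 (regχ3 4 (by norm_num)) hs hpos hχ0 hΨ horth
  try simp only [Function.iterate_zero, id_eq] at hP0 hZ0 hC0 hR0 hX0 hB0 hY0 hRR0
  -- the datum
  have nnL0 : 0 ≤ (∫ p in strip, radialWeight p.1 ^ 2 * ellipticOp α Ψ p.1 p.2 ^ 2 * Real.sin (2 * p.2) ^ (-eta)) := setIntegral_nonneg measurableSet_strip fun p hp => strip_integrand_nonneg hp _ _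
  have nnL1 : 0 ≤ (∫ p in strip, radialWeight p.1 ^ 2 * (Dz^[1] (ellipticOp α Ψ)) p.1 p.2 ^ 2 * Real.sin (2 * p.2) ^ (-eta)) := setIntegral_nonneg measurableSet_strip fun p hp => strip_integrand_nonneg hp _ _
  have nnL2 : 0 ≤ (∫ p in strip, radialWeight p.1 ^ 2 * (Dz^[2] (ellipticOp α Ψ)) p.1 p.2 ^ 2 * Real.sin (2 * p.2) ^ (-eta)) := setIntegral_nonneg measurableSet_strip fun p hp => strip_integrand_nonneg hp _ _
  have nnL3 : 0 ≤ (∫ p in strip, radialWeight p.1 ^ 2 * (Dz^[3] (ellipticOp α Ψ)) p.1 p.2 ^ 2 * Real.sin (2 * p.2) ^ (-eta)) := setIntegral_nonneg measurableSet_strip fun p hp => strip_integrand_nonneg hp _ _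
  have nnL4 : 0 ≤ (∫ p in strip, radialWeight p.1 ^ 2 * (Dz^[4] (ellipticOp α Ψ)) p.1 p.2 ^ 2 * Real.sin (2 * p.2) ^ (-eta)) := setIntegral_nonneg measurableSet_strip fun p hp => strip_integrand_nonneg hp _ _
  have nnF10 : 0 ≤ (∫ p in strip, radialWeight p.1 ^ 2 * dθ gF p.1 p.2 ^ 2 * Real.sin (2 * p.2) ^ (2 - gammaExp α)) := setIntegral_nonneg measurableSet_strip fun p hp => strip_integrand_nonneg hp _ _
  have nnF11 : 0 ≤ (∫ p in strip, radialWeight p.1 ^ 2 * dθ (Dz^[1] gF) p.1 p.2 ^ 2 * Real.sin (2 * p.2) ^ (2 - gammaExp α)) := setIntegral_nonneg measurableSet_strip fun p hp => strip_integrand_nonneg hp _ _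
  have nnF12 : 0 ≤ (∫ p in strip, radialWeight p.1 ^ 2 * dθ (Dz^[2] gF) p.1 p.2 ^ 2 * Real.sin (2 * p.2) ^ (2 - gammaExp α)) := setIntegral_nonneg measurableSet_strip fun p hp => strip_integrand_nonneg hp _ _
  have nnF13 : 0 ≤ (∫ p in strip, radialWeight p.1 ^ 2 * dθ (Dz^[3] gF) p.1 p.2 ^ 2 * Real.sin (2 * p.2) ^ (2 - gammaExp α)) := setIntegral_nonneg measurableSet_strip fun p hp => strip_integrand_nonneg hp _ _
  have nnF20 : 0 ≤ (∫ p in strip, radialWeight p.1 ^ 2 * dθ (dθ gF) p.1 p.2 ^ 2 * Real.sin (2 * p.2) ^ (4 - gammaExp α)) := setIntegral_nonneg measurableSet_strip fun p hp => strip_integrand_nonneg hp _ _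
  have nnF21 : 0 ≤ (∫ p in strip, radialWeight p.1 ^ 2 * dθ (dθ (Dz^[1] gF)) p.1 p.2 ^ 2 * Real.sin (2 * p.2) ^ (4 - gammaExp α)) := setIntegral_nonneg measurableSet_strip fun p hp => strip_integrand_nonneg hp _ _
  have nnF22 : 0 ≤ (∫ p in strip, radialWeight p.1 ^ 2 * dθ (dθ (Dz^[2] gF)) p.1 p.2 ^ 2 * Real.sin (2 * p.2) ^ (4 - gammaExp α)) := setIntegral_nonneg measurableSet_strip fun p hp => strip_integrand_nonneg hp _ _
  have nnF30 : 0 ≤ (∫ p in strip, radialWeight p.1 ^ 2 * (dθ^[3] gF) p.1 p.2 ^ 2 * Real.sin (2 * p.2) ^ (6 - gammaExp α)) := setIntegral_nonneg measurableSet_strip fun p hp => strip_integrand_nonneg hp _ _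
  have nnF31 : 0 ≤ (∫ p in strip, radialWeight p.1 ^ 2 * (dθ^[3] (Dz^[1] gF)) p.1 p.2 ^ 2 * Real.sin (2 * p.2) ^ (6 - gammaExp α)) := setIntegral_nonneg measurableSet_strip fun p hp => strip_integrand_nonneg hp _ _
  have nnF40 : 0 ≤ (∫ p in strip, radialWeight p.1 ^ 2 * (dθ^[4] gF) p.1 p.2 ^ 2 * Real.sin (2 * p.2) ^ (8 - gammaExp α)) := setIntegral_nonneg measurableSet_strip fun p hp => strip_integrand_nonneg hp _ _
  have dL0 : (∫ p in strip, radialWeight p.1 ^ 2 * ellipticOp α Ψ p.1 p.2 ^ 2 * Real.sin (2 * p.2) ^ (-eta)) ≤ D := by rw [hD]; linarith only [nnL0, nnL1, nnL2, nnL3, nnL4, nnF10, nnF11, nnF12, nnF13, nnF20, nnF21, nnF22, nnF30, nnF31, nnF40]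
  have dL1 : (∫ p in strip, radialWeight p.1 ^ 2 * (Dz^[1] (ellipticOp α Ψ)) p.1 p.2 ^ 2 * Real.sin (2 * p.2) ^ (-eta)) ≤ D := by rw [hD]; linarith only [nnL0, nnL1, nnL2, nnL3, nnL4, nnF10, nnF11, nnF12, nnF13, nnF20, nnF21, nnF22, nnF30, nnF31, nnF40]
  have dL2 : (∫ p in strip, radialWeight p.1 ^ 2 * (Dz^[2] (ellipticOp α Ψ)) p.1 p.2 ^ 2 * Real.sin (2 * p.2) ^ (-eta)) ≤ D := by rw [hD]; linarith only [nnL0, nnL1, nnL2, nnL3, nnL4, nnF10, nnF11, nnF12, nnF13, nnF20, nnF21, nnF22, nnF30, nnF31, nnF40]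
  have dL3 : (∫ p in strip, radialWeight p.1 ^ 2 * (Dz^[3] (ellipticOp α Ψ)) p.1 p.2 ^ 2 * Real.sin (2 * p.2) ^ (-eta)) ≤ D := by rw [hD]; linarith only [nnL0, nnL1, nnL2, nnL3, nnL4, nnF10, nnF11, nnF12, nnF13, nnF20, nnF21, nnF22, nnF30, nnF31, nnF40]
  have dL4 : (∫ p in strip, radialWeight p.1 ^ 2 * (Dz^[4] (ellipticOp α Ψ)) p.1 p.2 ^ 2 * Real.sin (2 * p.2) ^ (-eta)) ≤ D := by rw [hD]; linarith only [nnL0, nnL1, nnL2, nnL3, nnL4, nnF10, nnF11, nnF12, nnF13, nnF20, nnF21, nnF22, nnF30, nnF31, nnF40]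
  have dF10 : (∫ p in strip, radialWeight p.1 ^ 2 * dθ gF p.1 p.2 ^ 2 * Real.sin (2 * p.2) ^ (2 - gammaExp α)) ≤ D := by rw [hD]; linarith only [nnL0, nnL1, nnL2, nnL3, nnL4, nnF10, nnF11, nnF12, nnF13, nnF20, nnF21, nnF22, nnF30, nnF31, nnF40]
  have dF11 : (∫ p in strip, radialWeight p.1 ^ 2 * dθ (Dz^[1] gF) p.1 p.2 ^ 2 * Real.sin (2 * p.2) ^ (2 - gammaExp α)) ≤ D := by rw [hD]; linarith only [nnL0, nnL1, nnL2, nnL3, nnL4, nnF10, nnF11, nnF12, nnF13, nnF20, nnF21, nnF22, nnF30, nnF31, nnF40]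
  have dF12 : (∫ p in strip, radialWeight p.1 ^ 2 * dθ (Dz^[2] gF) p.1 p.2 ^ 2 * Real.sin (2 * p.2) ^ (2 - gammaExp α)) ≤ D := by rw [hD]; linarith only [nnL0, nnL1, nnL2, nnL3, nnL4, nnF10, nnF11, nnF12, nnF13, nnF20, nnF21, nnF22, nnF30, nnF31, nnF40]
  have dF13 : (∫ p in strip, radialWeight p.1 ^ 2 * dθ (Dz^[3] gF) p.1 p.2 ^ 2 * Real.sin (2 * p.2) ^ (2 - gammaExp α)) ≤ D := by rw [hD]; linarith only [nnL0, nnL1, nnL2, nnL3, nnL4, nnF10, nnF11, nnF12, nnF13, nnF20, nnF21, nnF22, nnF30, nnF31, nnF40]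
  have dF20 : (∫ p in strip, radialWeight p.1 ^ 2 * dθ (dθ gF) p.1 p.2 ^ 2 * Real.sin (2 * p.2) ^ (4 - gammaExp α)) ≤ D := by rw [hD]; linarith only [nnL0, nnL1, nnL2, nnL3, nnL4, nnF10, nnF11, nnF12, nnF13, nnF20, nnF21, nnF22, nnF30, nnF31, nnF40]
  have dF21 : (∫ p in strip, radialWeight p.1 ^ 2 * dθ (dθ (Dz^[1] gF)) p.1 p.2 ^ 2 * Real.sin (2 * p.2) ^ (4 - gammaExp α)) ≤ D := by rw [hD]; linarith only [nnL0, nnL1, nnL2, nnL3, nnL4, nnF10, nnF11, nnF12, nnF13, nnF20, nnF21, nnF22, nnF30, nnF31, nnF40]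
  have dF22 : (∫ p in strip, radialWeight p.1 ^ 2 * dθ (dθ (Dz^[2] gF)) p.1 p.2 ^ 2 * Real.sin (2 * p.2) ^ (4 - gammaExp α)) ≤ D := by rw [hD]; linarith only [nnL0, nnL1, nnL2, nnL3, nnL4, nnF10, nnF11, nnF12, nnF13, nnF20, nnF21, nnF22, nnF30, nnF31, nnF40]
  have dF30 : (∫ p in strip, radialWeight p.1 ^ 2 * (dθ^[3] gF) p.1 p.2 ^ 2 * Real.sin (2 * p.2) ^ (6 - gammaExp α)) ≤ D := by rw [hD]; linarith only [nnL0, nnL1, nnL2, nnL3, nnL4, nnF10, nnF11, nnF12, nnF13, nnF20, nnF21, nnF22, nnF30, nnF31, nnF40]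
  have dF31 : (∫ p in strip, radialWeight p.1 ^ 2 * (dθ^[3] (Dz^[1] gF)) p.1 p.2 ^ 2 * Real.sin (2 * p.2) ^ (6 - gammaExp α)) ≤ D := by rw [hD]; linarith only [nnL0, nnL1, nnL2, nnL3, nnL4, nnF10, nnF11, nnF12, nnF13, nnF20, nnF21, nnF22, nnF30, nnF31, nnF40]
  have dF40 : (∫ p in strip, radialWeight p.1 ^ 2 * (dθ^[4] gF) p.1 p.2 ^ 2 * Real.sin (2 * p.2) ^ (8 - gammaExp α)) ≤ D := by rw [hD]; linarith only [nnL0, nnL1, nnL2, nnL3, nnL4, nnF10, nnF11, nnF12, nnF13, nnF20, nnF21, nnF22, nnF30, nnF31, nnF40]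
  have hD0 : 0 ≤ D := by rw [hD]; linarith only [nnL0, nnL1, nnL2, nnL3, nnL4, nnF10, nnF11, nnF12, nnF13, nnF20, nnF21, nnF22, nnF30, nnF31, nnF40]
  have hr0_1 : (0:ℝ) ≤ 2 - gammaExp α := by linarith
  have hr1_1 : (2:ℝ) - gammaExp α ≤ 2 * (1:ℕ) + 2 := by push_cast; linarith
  have hr0_2 : (0:ℝ) ≤ 4 - gammaExp α := by linarith
  have hr1_2 : (4:ℝ) - gammaExp α ≤ 2 * (2:ℕ) + 2 := by push_cast; linarith
  have hr0_3 : (0:ℝ) ≤ 6 - gammaExp α := by linarith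
  have hr1_3 : (6:ℝ) - gammaExp α ≤ 2 * (3:ℕ) + 2 := by push_cast; linarith
  have hr0_4 : (0:ℝ) ≤ 8 - gammaExp α := by linarith
  have hr1_4 : (8:ℝ) - gammaExp α ≤ 2 * (4:ℕ) + 2 := by push_cast; linarith
  ----------------------------------------------------------------
  -- level (1, 0)
  ----------------------------------------------------------------
  have hLev10 := angular_level_estimate 1 (r := 2 - gammaExp α) hr0_1 hr1_1 hWc hW0 (regχj 1 0 (by norm_num)) (hsj 0) (hposj 0) (hΨj 0 (by norm_num))
  try simp only [Nat.reduceAdd, Nat.reduceMul, Nat.reducePow, Nat.cast_one, Nat.cast_ofNat, Finset.sum_range_succ, Finset.sum_range_zero, zero_add, Function.iterate_zero, id_eq, iterate_dθ_one, iterate_dθ_two] at hLev10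
  have hDat10 := angular_data_bound α 1 0 hr0_1 hWc hW0 (regχd 1 0 (by norm_num)) hs hpos hΨ hgF
  try simp only [Nat.reduceAdd, Nat.reduceMul, Nat.reducePow, Nat.cast_one, Nat.cast_ofNat, Finset.sum_range_succ, Finset.sum_range_zero, zero_add, Function.iterate_zero, id_eq, iterate_dθ_one, iterate_dθ_two] at hDat10
  have hT0_10 := integral_weight_rpow_le_singular hWc hW0 (cΨ 1 0 (by norm_num)) (sΨ 1 0) (pΨ 1 0) hr0_1
  have hT1_10 := integral_weight_rpow_le_singular hWc hW0 (cΨ 1 1 (by norm_num)) (sΨ 1 1) (pΨ 1 1) hr0_1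
  try simp only [Nat.reduceAdd, Nat.reduceMul, Nat.reducePow, Nat.cast_one, Nat.cast_ofNat, Finset.sum_range_succ, Finset.sum_range_zero, zero_add, Function.iterate_zero, id_eq, iterate_dθ_one, iterate_dθ_two] at hT0_10 hT1_10
  have eT2_10 : (∫ p in strip, radialWeight p.1 ^ 2 * dθ (Dz^[2] Ψ) p.1 p.2 ^ 2 * Real.sin (2 * p.2) ^ (2 - gammaExp α)) =
      ∫ p in strip, radialWeight p.1 ^ 2 * (p.1 * dz (dθ (Dz^[1] Ψ)) p.1 p.2) ^ 2 * Real.sin (2 * p.2) ^ (2 - gammaExp α) := by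
    refine setIntegral_congr_fun measurableSet_strip fun p hp => ?_
    have h2 : ContDiff ℝ 2 (uncurry (Dz^[1] Ψ)) := by
      have h1 : ContDiff ℝ ((2 + 1 : ℕ) : WithTop ℕ∞) (uncurry Ψ) := hΨc.of_le (by norm_num)
      have := contDiff_iterate_Dz_of_contDiff (m := 1) (n := 2) (by exact_mod_cast h1); exact_mod_cast this
    rw [show (Dz^[2] Ψ) = Dz (Dz^[1] Ψ) from Function.iterate_succ_apply' Dz 1 Ψ, dθ_Dz_strip h2 hp]
  have hT2_10 := integral_weight_rpow_le_singular hWc hW0 (cZ 1 (by norm_num)) (sZ 1) (pZ 1) hr0_1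
  try simp only [Nat.reduceAdd, Nat.reduceMul, Nat.reducePow, Nat.cast_one, Nat.cast_ofNat, Finset.sum_range_succ, Finset.sum_range_zero, zero_add, Function.iterate_zero, id_eq, iterate_dθ_one, iterate_dθ_two] at hT2_10
  have eZ_10 : (∫ p in strip, radialWeight p.1 ^ 2 * (p.1 * dz (dθ (Dz^[1] Ψ)) p.1 p.2) ^ 2 * Real.sin (2 * p.2) ^ (-eta)) =
      ∫ p in strip, p.1 ^ 2 * radialWeight p.1 ^ 2 * dz (dθ (Dz^[1] Ψ)) p.1 p.2 ^ 2 * Real.sin (2 * p.2) ^ (-eta) :=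
    integral_congr_ae (ae_of_all _ fun p => by ring)
  rw [eZ_10] at hT2_10
  rw [← eT2_10] at hT2_10
  have nnT2_10 : 0 ≤ ∫ p in strip, radialWeight p.1 ^ 2 * dθ (Dz^[2] Ψ) p.1 p.2 ^ 2 * Real.sin (2 * p.2) ^ (2 - gammaExp α) :=
    setIntegral_nonneg measurableSet_strip fun p hp => strip_integrand_nonneg hp _ _
  have nnZ_10 : 0 ≤ ∫ p in strip, p.1 ^ 2 * radialWeight p.1 ^ 2 * dz (dθ (Dz^[1] Ψ)) p.1 p.2 ^ 2 * Real.sin (2 * p.2) ^ (-eta) :=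
    setIntegral_nonneg measurableSet_strip fun p hp => strip_integrand_nonneg' hp _ _
  have aT2_10 : α ^ 4 * (∫ p in strip, radialWeight p.1 ^ 2 * dθ (Dz^[2] Ψ) p.1 p.2 ^ 2 * Real.sin (2 * p.2) ^ (2 - gammaExp α)) ≤
      α ^ 2 * (α ^ 2 * ∫ p in strip, p.1 ^ 2 * radialWeight p.1 ^ 2 * dz (dθ (Dz^[1] Ψ)) p.1 p.2 ^ 2 * Real.sin (2 * p.2) ^ (-eta)) := by
    rw [show α ^ 4 = α ^ 2 * α ^ 2 by ring, mul_assoc]; exact mul_le_mul_of_nonneg_left (mul_le_mul_of_nonneg_left hT2_10 hα20) hα20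
  have aT2'_10 : α ^ 2 * (α ^ 2 * ∫ p in strip, p.1 ^ 2 * radialWeight p.1 ^ 2 * dz (dθ (Dz^[1] Ψ)) p.1 p.2 ^ 2 * Real.sin (2 * p.2) ^ (-eta)) ≤
      1 * (α ^ 2 * ∫ p in strip, p.1 ^ 2 * radialWeight p.1 ^ 2 * dz (dθ (Dz^[1] Ψ)) p.1 p.2 ^ 2 * Real.sin (2 * p.2) ^ (-eta)) :=
    mul_le_mul_of_nonneg_right hα2 (mul_nonneg hα20 nnZ_10)
  have nnT1_10 : 0 ≤ ∫ p in strip, radialWeight p.1 ^ 2 * dθ (Dz^[1] Ψ) p.1 p.2 ^ 2 * Real.sin (2 * p.2) ^ (2 - gammaExp α) :=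
    setIntegral_nonneg measurableSet_strip fun p hp => strip_integrand_nonneg hp _ _
  have aT1_10 : α ^ 2 * (∫ p in strip, radialWeight p.1 ^ 2 * dθ (Dz^[1] Ψ) p.1 p.2 ^ 2 * Real.sin (2 * p.2) ^ (2 - gammaExp α)) ≤
      1 * ∫ p in strip, radialWeight p.1 ^ 2 * dθ (Dz^[1] Ψ) p.1 p.2 ^ 2 * Real.sin (2 * p.2) ^ (2 - gammaExp α) := mul_le_mul_of_nonneg_right hα2 nnT1_10
  have hlow0_10 := integral_weight_rpow_le_singular hWc hW0 (cχ 0 0 (by norm_num)) (sχ 0 0) (pχ 0 0) hr0_1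
  have hlow1_10 := integral_weight_rpow_le_singular hWc hW0 (cχ 1 0 (by norm_num)) (sχ 1 0) (pχ 1 0) hr0_1
  try simp only [Nat.reduceAdd, Nat.reduceMul, Nat.reducePow, Nat.cast_one, Nat.cast_ofNat, Finset.sum_range_succ, Finset.sum_range_zero, zero_add, Function.iterate_zero, id_eq, iterate_dθ_one, iterate_dθ_two] at hlow0_10 hlow1_10
  have res10 : (∫ p in strip, radialWeight p.1 ^ 2 * (dθ^[3] Ψ) p.1 p.2 ^ 2 * Real.sin (2 * p.2) ^ (2 - gammaExp α)) +
      (∫ p in strip, radialWeight p.1 ^ 2 * dθ (dθ χ) p.1 p.2 ^ 2 * Real.sin (2 * p.2) ^ (2 - gammaExp α)) ≤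
      200000000 * D := by
    linarith only [hLev10, hDat10, hT0_10, hT1_10, aT2_10, aT2'_10, aT1_10, hY0, hY1, hZ1, nnT2_10, nnZ_10, nnT1_10, hlow0_10, hlow1_10, hB0, hC0, dF10, hD0, dL0, dL1, dL2, dL3, dL4]
  ----------------------------------------------------------------
  -- level (1, 1)
  ----------------------------------------------------------------
  have hLev11 := angular_level_estimate 1 (r := 2 - gammaExp α) hr0_1 hr1_1 hWc hW0 (regχj 1 1 (by norm_num)) (hsj 1) (hposj 1) (hΨj 1 (by norm_num))
  try simp only [Nat.reduceAdd, Nat.reduceMul, Nat.reducePow, Nat.cast_one, Nat.cast_ofNat, Finset.sum_range_succ, Finset.sum_range_zero, zero_add, Function.iterate_zero, id_eq, iterate_dθ_one, iterate_dθ_two] at hLev11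
  have hDat11 := angular_data_bound α 1 1 hr0_1 hWc hW0 (regχd 1 1 (by norm_num)) hs hpos hΨ hgF
  try simp only [Nat.reduceAdd, Nat.reduceMul, Nat.reducePow, Nat.cast_one, Nat.cast_ofNat, Finset.sum_range_succ, Finset.sum_range_zero, zero_add, Function.iterate_zero, id_eq, iterate_dθ_one, iterate_dθ_two] at hDat11
  have hT0_11 := integral_weight_rpow_le_singular hWc hW0 (cΨ 1 1 (by norm_num)) (sΨ 1 1) (pΨ 1 1) hr0_1
  have hT1_11 := integral_weight_rpow_le_singular hWc hW0 (cΨ 1 2 (by norm_num)) (sΨ 1 2) (pΨ 1 2) hr0_1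
  try simp only [Nat.reduceAdd, Nat.reduceMul, Nat.reducePow, Nat.cast_one, Nat.cast_ofNat, Finset.sum_range_succ, Finset.sum_range_zero, zero_add, Function.iterate_zero, id_eq, iterate_dθ_one, iterate_dθ_two] at hT0_11 hT1_11
  have eT2_11 : (∫ p in strip, radialWeight p.1 ^ 2 * dθ (Dz^[3] Ψ) p.1 p.2 ^ 2 * Real.sin (2 * p.2) ^ (2 - gammaExp α)) =
      ∫ p in strip, radialWeight p.1 ^ 2 * (p.1 * dz (dθ (Dz^[2] Ψ)) p.1 p.2) ^ 2 * Real.sin (2 * p.2) ^ (2 - gammaExp α) := by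
    refine setIntegral_congr_fun measurableSet_strip fun p hp => ?_
    have h2 : ContDiff ℝ 2 (uncurry (Dz^[2] Ψ)) := by
      have h1 : ContDiff ℝ ((2 + 2 : ℕ) : WithTop ℕ∞) (uncurry Ψ) := hΨc.of_le (by norm_num)
      have := contDiff_iterate_Dz_of_contDiff (m := 2) (n := 2) (by exact_mod_cast h1); exact_mod_cast this
    rw [show (Dz^[3] Ψ) = Dz (Dz^[2] Ψ) from Function.iterate_succ_apply' Dz 2 Ψ, dθ_Dz_strip h2 hp]
  have hT2_11 := integral_weight_rpow_le_singular hWc hW0 (cZ 2 (by norm_num)) (sZ 2) (pZ 2) hr0_1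
  try simp only [Nat.reduceAdd, Nat.reduceMul, Nat.reducePow, Nat.cast_one, Nat.cast_ofNat, Finset.sum_range_succ, Finset.sum_range_zero, zero_add, Function.iterate_zero, id_eq, iterate_dθ_one, iterate_dθ_two] at hT2_11
  have eZ_11 : (∫ p in strip, radialWeight p.1 ^ 2 * (p.1 * dz (dθ (Dz^[2] Ψ)) p.1 p.2) ^ 2 * Real.sin (2 * p.2) ^ (-eta)) =
      ∫ p in strip, p.1 ^ 2 * radialWeight p.1 ^ 2 * dz (dθ (Dz^[2] Ψ)) p.1 p.2 ^ 2 * Real.sin (2 * p.2) ^ (-eta) :=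
    integral_congr_ae (ae_of_all _ fun p => by ring)
  rw [eZ_11] at hT2_11
  rw [← eT2_11] at hT2_11
  have nnT2_11 : 0 ≤ ∫ p in strip, radialWeight p.1 ^ 2 * dθ (Dz^[3] Ψ) p.1 p.2 ^ 2 * Real.sin (2 * p.2) ^ (2 - gammaExp α) :=
    setIntegral_nonneg measurableSet_strip fun p hp => strip_integrand_nonneg hp _ _
  have nnZ_11 : 0 ≤ ∫ p in strip, p.1 ^ 2 * radialWeight p.1 ^ 2 * dz (dθ (Dz^[2] Ψ)) p.1 p.2 ^ 2 * Real.sin (2 * p.2) ^ (-eta) :=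
    setIntegral_nonneg measurableSet_strip fun p hp => strip_integrand_nonneg' hp _ _
  have aT2_11 : α ^ 4 * (∫ p in strip, radialWeight p.1 ^ 2 * dθ (Dz^[3] Ψ) p.1 p.2 ^ 2 * Real.sin (2 * p.2) ^ (2 - gammaExp α)) ≤
      α ^ 2 * (α ^ 2 * ∫ p in strip, p.1 ^ 2 * radialWeight p.1 ^ 2 * dz (dθ (Dz^[2] Ψ)) p.1 p.2 ^ 2 * Real.sin (2 * p.2) ^ (-eta)) := by
    rw [show α ^ 4 = α ^ 2 * α ^ 2 by ring, mul_assoc]; exact mul_le_mul_of_nonneg_left (mul_le_mul_of_nonneg_left hT2_11 hα20) hα20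
  have aT2'_11 : α ^ 2 * (α ^ 2 * ∫ p in strip, p.1 ^ 2 * radialWeight p.1 ^ 2 * dz (dθ (Dz^[2] Ψ)) p.1 p.2 ^ 2 * Real.sin (2 * p.2) ^ (-eta)) ≤
      1 * (α ^ 2 * ∫ p in strip, p.1 ^ 2 * radialWeight p.1 ^ 2 * dz (dθ (Dz^[2] Ψ)) p.1 p.2 ^ 2 * Real.sin (2 * p.2) ^ (-eta)) :=
    mul_le_mul_of_nonneg_right hα2 (mul_nonneg hα20 nnZ_11)
  have nnT1_11 : 0 ≤ ∫ p in strip, radialWeight p.1 ^ 2 * dθ (Dz^[2] Ψ) p.1 p.2 ^ 2 * Real.sin (2 * p.2) ^ (2 - gammaExp α) :=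
    setIntegral_nonneg measurableSet_strip fun p hp => strip_integrand_nonneg hp _ _
  have aT1_11 : α ^ 2 * (∫ p in strip, radialWeight p.1 ^ 2 * dθ (Dz^[2] Ψ) p.1 p.2 ^ 2 * Real.sin (2 * p.2) ^ (2 - gammaExp α)) ≤
      1 * ∫ p in strip, radialWeight p.1 ^ 2 * dθ (Dz^[2] Ψ) p.1 p.2 ^ 2 * Real.sin (2 * p.2) ^ (2 - gammaExp α) := mul_le_mul_of_nonneg_right hα2 nnT1_11
  have hlow0_11 := integral_weight_rpow_le_singular hWc hW0 (cχ 0 1 (by norm_num)) (sχ 0 1) (pχ 0 1) hr0_1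
  have hlow1_11 := integral_weight_rpow_le_singular hWc hW0 (cχ 1 1 (by norm_num)) (sχ 1 1) (pχ 1 1) hr0_1
  try simp only [Nat.reduceAdd, Nat.reduceMul, Nat.reducePow, Nat.cast_one, Nat.cast_ofNat, Finset.sum_range_succ, Finset.sum_range_zero, zero_add, Function.iterate_zero, id_eq, iterate_dθ_one, iterate_dθ_two] at hlow0_11 hlow1_11
  have res11 : (∫ p in strip, radialWeight p.1 ^ 2 * (dθ^[3] (Dz^[1] Ψ)) p.1 p.2 ^ 2 * Real.sin (2 * p.2) ^ (2 - gammaExp α)) +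
      (∫ p in strip, radialWeight p.1 ^ 2 * dθ (dθ (Dz^[1] χ)) p.1 p.2 ^ 2 * Real.sin (2 * p.2) ^ (2 - gammaExp α)) ≤
      200000000 * D := by
    linarith only [hLev11, hDat11, hT0_11, hT1_11, aT2_11, aT2'_11, aT1_11, hY1, hY2, hZ2, nnT2_11, nnZ_11, nnT1_11, hlow0_11, hlow1_11, hB1, hC1, dF11, hD0, dL0, dL1, dL2, dL3, dL4]
  ----------------------------------------------------------------
  -- level (1, 2)
  ----------------------------------------------------------------
  have hLev12 := angular_level_estimate 1 (r := 2 - gammaExp α) hr0_1 hr1_1 hWc hW0 (regχj 1 2 (by norm_num)) (hsj 2) (hposj 2) (hΨj 2 (by norm_num))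
  try simp only [Nat.reduceAdd, Nat.reduceMul, Nat.reducePow, Nat.cast_one, Nat.cast_ofNat, Finset.sum_range_succ, Finset.sum_range_zero, zero_add, Function.iterate_zero, id_eq, iterate_dθ_one, iterate_dθ_two] at hLev12
  have hDat12 := angular_data_bound α 1 2 hr0_1 hWc hW0 (regχd 1 2 (by norm_num)) hs hpos hΨ hgF
  try simp only [Nat.reduceAdd, Nat.reduceMul, Nat.reducePow, Nat.cast_one, Nat.cast_ofNat, Finset.sum_range_succ, Finset.sum_range_zero, zero_add, Function.iterate_zero, id_eq, iterate_dθ_one, iterate_dθ_two] at hDat12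
  have hT0_12 := integral_weight_rpow_le_singular hWc hW0 (cΨ 1 2 (by norm_num)) (sΨ 1 2) (pΨ 1 2) hr0_1
  have hT1_12 := integral_weight_rpow_le_singular hWc hW0 (cΨ 1 3 (by norm_num)) (sΨ 1 3) (pΨ 1 3) hr0_1
  try simp only [Nat.reduceAdd, Nat.reduceMul, Nat.reducePow, Nat.cast_one, Nat.cast_ofNat, Finset.sum_range_succ, Finset.sum_range_zero, zero_add, Function.iterate_zero, id_eq, iterate_dθ_one, iterate_dθ_two] at hT0_12 hT1_12
  have eT2_12 : (∫ p in strip, radialWeight p.1 ^ 2 * dθ (Dz^[4] Ψ) p.1 p.2 ^ 2 * Real.sin (2 * p.2) ^ (2 - gammaExp α)) =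
      ∫ p in strip, radialWeight p.1 ^ 2 * (p.1 * dz (dθ (Dz^[3] Ψ)) p.1 p.2) ^ 2 * Real.sin (2 * p.2) ^ (2 - gammaExp α) := by
    refine setIntegral_congr_fun measurableSet_strip fun p hp => ?_
    have h2 : ContDiff ℝ 2 (uncurry (Dz^[3] Ψ)) := by
      have h1 : ContDiff ℝ ((2 + 3 : ℕ) : WithTop ℕ∞) (uncurry Ψ) := hΨc.of_le (by norm_num)
      have := contDiff_iterate_Dz_of_contDiff (m := 3) (n := 2) (by exact_mod_cast h1); exact_mod_cast this
    rw [show (Dz^[4] Ψ) = Dz (Dz^[3] Ψ) from Function.iterate_succ_apply' Dz 3 Ψ, dθ_Dz_strip h2 hp]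
  have hT2_12 := integral_weight_rpow_le_singular hWc hW0 (cZ 3 (by norm_num)) (sZ 3) (pZ 3) hr0_1
  try simp only [Nat.reduceAdd, Nat.reduceMul, Nat.reducePow, Nat.cast_one, Nat.cast_ofNat, Finset.sum_range_succ, Finset.sum_range_zero, zero_add, Function.iterate_zero, id_eq, iterate_dθ_one, iterate_dθ_two] at hT2_12
  have eZ_12 : (∫ p in strip, radialWeight p.1 ^ 2 * (p.1 * dz (dθ (Dz^[3] Ψ)) p.1 p.2) ^ 2 * Real.sin (2 * p.2) ^ (-eta)) =
      ∫ p in strip, p.1 ^ 2 * radialWeight p.1 ^ 2 * dz (dθ (Dz^[3] Ψ)) p.1 p.2 ^ 2 * Real.sin (2 * p.2) ^ (-eta) :=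
    integral_congr_ae (ae_of_all _ fun p => by ring)
  rw [eZ_12] at hT2_12
  rw [← eT2_12] at hT2_12
  have nnT2_12 : 0 ≤ ∫ p in strip, radialWeight p.1 ^ 2 * dθ (Dz^[4] Ψ) p.1 p.2 ^ 2 * Real.sin (2 * p.2) ^ (2 - gammaExp α) :=
    setIntegral_nonneg measurableSet_strip fun p hp => strip_integrand_nonneg hp _ _
  have nnZ_12 : 0 ≤ ∫ p in strip, p.1 ^ 2 * radialWeight p.1 ^ 2 * dz (dθ (Dz^[3] Ψ)) p.1 p.2 ^ 2 * Real.sin (2 * p.2) ^ (-eta) :=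
    setIntegral_nonneg measurableSet_strip fun p hp => strip_integrand_nonneg' hp _ _
  have aT2_12 : α ^ 4 * (∫ p in strip, radialWeight p.1 ^ 2 * dθ (Dz^[4] Ψ) p.1 p.2 ^ 2 * Real.sin (2 * p.2) ^ (2 - gammaExp α)) ≤
      α ^ 2 * (α ^ 2 * ∫ p in strip, p.1 ^ 2 * radialWeight p.1 ^ 2 * dz (dθ (Dz^[3] Ψ)) p.1 p.2 ^ 2 * Real.sin (2 * p.2) ^ (-eta)) := by
    rw [show α ^ 4 = α ^ 2 * α ^ 2 by ring, mul_assoc]; exact mul_le_mul_of_nonneg_left (mul_le_mul_of_nonneg_left hT2_12 hα20) hα20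
  have aT2'_12 : α ^ 2 * (α ^ 2 * ∫ p in strip, p.1 ^ 2 * radialWeight p.1 ^ 2 * dz (dθ (Dz^[3] Ψ)) p.1 p.2 ^ 2 * Real.sin (2 * p.2) ^ (-eta)) ≤
      1 * (α ^ 2 * ∫ p in strip, p.1 ^ 2 * radialWeight p.1 ^ 2 * dz (dθ (Dz^[3] Ψ)) p.1 p.2 ^ 2 * Real.sin (2 * p.2) ^ (-eta)) :=
    mul_le_mul_of_nonneg_right hα2 (mul_nonneg hα20 nnZ_12)
  have nnT1_12 : 0 ≤ ∫ p in strip, radialWeight p.1 ^ 2 * dθ (Dz^[3] Ψ) p.1 p.2 ^ 2 * Real.sin (2 * p.2) ^ (2 - gammaExp α) :=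
    setIntegral_nonneg measurableSet_strip fun p hp => strip_integrand_nonneg hp _ _
  have aT1_12 : α ^ 2 * (∫ p in strip, radialWeight p.1 ^ 2 * dθ (Dz^[3] Ψ) p.1 p.2 ^ 2 * Real.sin (2 * p.2) ^ (2 - gammaExp α)) ≤
      1 * ∫ p in strip, radialWeight p.1 ^ 2 * dθ (Dz^[3] Ψ) p.1 p.2 ^ 2 * Real.sin (2 * p.2) ^ (2 - gammaExp α) := mul_le_mul_of_nonneg_right hα2 nnT1_12
  have hlow0_12 := integral_weight_rpow_le_singular hWc hW0 (cχ 0 2 (by norm_num)) (sχ 0 2) (pχ 0 2) hr0_1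
  have hlow1_12 := integral_weight_rpow_le_singular hWc hW0 (cχ 1 2 (by norm_num)) (sχ 1 2) (pχ 1 2) hr0_1
  try simp only [Nat.reduceAdd, Nat.reduceMul, Nat.reducePow, Nat.cast_one, Nat.cast_ofNat, Finset.sum_range_succ, Finset.sum_range_zero, zero_add, Function.iterate_zero, id_eq, iterate_dθ_one, iterate_dθ_two] at hlow0_12 hlow1_12
  have res12 : (∫ p in strip, radialWeight p.1 ^ 2 * (dθ^[3] (Dz^[2] Ψ)) p.1 p.2 ^ 2 * Real.sin (2 * p.2) ^ (2 - gammaExp α)) +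
      (∫ p in strip, radialWeight p.1 ^ 2 * dθ (dθ (Dz^[2] χ)) p.1 p.2 ^ 2 * Real.sin (2 * p.2) ^ (2 - gammaExp α)) ≤
      200000000 * D := by
    linarith only [hLev12, hDat12, hT0_12, hT1_12, aT2_12, aT2'_12, aT1_12, hY2, hY3, hZ3, nnT2_12, nnZ_12, nnT1_12, hlow0_12, hlow1_12, hB2, hC2, dF12, hD0, dL0, dL1, dL2, dL3, dL4]
  ----------------------------------------------------------------
  -- level (1, 3)
  ----------------------------------------------------------------
  have hLev13 := angular_level_estimate 1 (r := 2 - gammaExp α) hr0_1 hr1_1 hWc hW0 (regχj 1 3 (by norm_num)) (hsj 3) (hposj 3) (hΨj 3 (by norm_num))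
  try simp only [Nat.reduceAdd, Nat.reduceMul, Nat.reducePow, Nat.cast_one, Nat.cast_ofNat, Finset.sum_range_succ, Finset.sum_range_zero, zero_add, Function.iterate_zero, id_eq, iterate_dθ_one, iterate_dθ_two] at hLev13
  have hDat13 := angular_data_bound α 1 3 hr0_1 hWc hW0 (regχd 1 3 (by norm_num)) hs hpos hΨ hgF
  try simp only [Nat.reduceAdd, Nat.reduceMul, Nat.reducePow, Nat.cast_one, Nat.cast_ofNat, Finset.sum_range_succ, Finset.sum_range_zero, zero_add, Function.iterate_zero, id_eq, iterate_dθ_one, iterate_dθ_two] at hDat13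
  have hT0_13 := integral_weight_rpow_le_singular hWc hW0 (cΨ 1 3 (by norm_num)) (sΨ 1 3) (pΨ 1 3) hr0_1
  have hT1_13 := integral_weight_rpow_le_singular hWc hW0 (cΨ 1 4 (by norm_num)) (sΨ 1 4) (pΨ 1 4) hr0_1
  try simp only [Nat.reduceAdd, Nat.reduceMul, Nat.reducePow, Nat.cast_one, Nat.cast_ofNat, Finset.sum_range_succ, Finset.sum_range_zero, zero_add, Function.iterate_zero, id_eq, iterate_dθ_one, iterate_dθ_two] at hT0_13 hT1_13
  have eT2_13 : (∫ p in strip, radialWeight p.1 ^ 2 * dθ (Dz^[5] Ψ) p.1 p.2 ^ 2 * Real.sin (2 * p.2) ^ (2 - gammaExp α)) =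
      ∫ p in strip, radialWeight p.1 ^ 2 * (p.1 * dz (dθ (Dz^[4] Ψ)) p.1 p.2) ^ 2 * Real.sin (2 * p.2) ^ (2 - gammaExp α) := by
    refine setIntegral_congr_fun measurableSet_strip fun p hp => ?_
    have h2 : ContDiff ℝ 2 (uncurry (Dz^[4] Ψ)) := by
      have h1 : ContDiff ℝ ((2 + 4 : ℕ) : WithTop ℕ∞) (uncurry Ψ) := hΨc.of_le (by norm_num)
      have := contDiff_iterate_Dz_of_contDiff (m := 4) (n := 2) (by exact_mod_cast h1); exact_mod_cast this
    rw [show (Dz^[5] Ψ) = Dz (Dz^[4] Ψ) from Function.iterate_succ_apply' Dz 4 Ψ, dθ_Dz_strip h2 hp]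
  have hT2_13 := integral_weight_rpow_le_singular hWc hW0 (cZ 4 (by norm_num)) (sZ 4) (pZ 4) hr0_1
  try simp only [Nat.reduceAdd, Nat.reduceMul, Nat.reducePow, Nat.cast_one, Nat.cast_ofNat, Finset.sum_range_succ, Finset.sum_range_zero, zero_add, Function.iterate_zero, id_eq, iterate_dθ_one, iterate_dθ_two] at hT2_13
  have eZ_13 : (∫ p in strip, radialWeight p.1 ^ 2 * (p.1 * dz (dθ (Dz^[4] Ψ)) p.1 p.2) ^ 2 * Real.sin (2 * p.2) ^ (-eta)) =
      ∫ p in strip, p.1 ^ 2 * radialWeight p.1 ^ 2 * dz (dθ (Dz^[4] Ψ)) p.1 p.2 ^ 2 * Real.sin (2 * p.2) ^ (-eta) :=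
    integral_congr_ae (ae_of_all _ fun p => by ring)
  rw [eZ_13] at hT2_13
  rw [← eT2_13] at hT2_13
  have nnT2_13 : 0 ≤ ∫ p in strip, radialWeight p.1 ^ 2 * dθ (Dz^[5] Ψ) p.1 p.2 ^ 2 * Real.sin (2 * p.2) ^ (2 - gammaExp α) :=
    setIntegral_nonneg measurableSet_strip fun p hp => strip_integrand_nonneg hp _ _
  have nnZ_13 : 0 ≤ ∫ p in strip, p.1 ^ 2 * radialWeight p.1 ^ 2 * dz (dθ (Dz^[4] Ψ)) p.1 p.2 ^ 2 * Real.sin (2 * p.2) ^ (-eta) :=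
    setIntegral_nonneg measurableSet_strip fun p hp => strip_integrand_nonneg' hp _ _
  have aT2_13 : α ^ 4 * (∫ p in strip, radialWeight p.1 ^ 2 * dθ (Dz^[5] Ψ) p.1 p.2 ^ 2 * Real.sin (2 * p.2) ^ (2 - gammaExp α)) ≤
      α ^ 2 * (α ^ 2 * ∫ p in strip, p.1 ^ 2 * radialWeight p.1 ^ 2 * dz (dθ (Dz^[4] Ψ)) p.1 p.2 ^ 2 * Real.sin (2 * p.2) ^ (-eta)) := by
    rw [show α ^ 4 = α ^ 2 * α ^ 2 by ring, mul_assoc]; exact mul_le_mul_of_nonneg_left (mul_le_mul_of_nonneg_left hT2_13 hα20) hα20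
  have aT2'_13 : α ^ 2 * (α ^ 2 * ∫ p in strip, p.1 ^ 2 * radialWeight p.1 ^ 2 * dz (dθ (Dz^[4] Ψ)) p.1 p.2 ^ 2 * Real.sin (2 * p.2) ^ (-eta)) ≤
      1 * (α ^ 2 * ∫ p in strip, p.1 ^ 2 * radialWeight p.1 ^ 2 * dz (dθ (Dz^[4] Ψ)) p.1 p.2 ^ 2 * Real.sin (2 * p.2) ^ (-eta)) :=
    mul_le_mul_of_nonneg_right hα2 (mul_nonneg hα20 nnZ_13)
  have nnT1_13 : 0 ≤ ∫ p in strip, radialWeight p.1 ^ 2 * dθ (Dz^[4] Ψ) p.1 p.2 ^ 2 * Real.sin (2 * p.2) ^ (2 - gammaExp α) :=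
    setIntegral_nonneg measurableSet_strip fun p hp => strip_integrand_nonneg hp _ _
  have aT1_13 : α ^ 2 * (∫ p in strip, radialWeight p.1 ^ 2 * dθ (Dz^[4] Ψ) p.1 p.2 ^ 2 * Real.sin (2 * p.2) ^ (2 - gammaExp α)) ≤
      1 * ∫ p in strip, radialWeight p.1 ^ 2 * dθ (Dz^[4] Ψ) p.1 p.2 ^ 2 * Real.sin (2 * p.2) ^ (2 - gammaExp α) := mul_le_mul_of_nonneg_right hα2 nnT1_13
  have hlow0_13 := integral_weight_rpow_le_singular hWc hW0 (cχ 0 3 (by norm_num)) (sχ 0 3) (pχ 0 3) hr0_1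
  have hlow1_13 := integral_weight_rpow_le_singular hWc hW0 (cχ 1 3 (by norm_num)) (sχ 1 3) (pχ 1 3) hr0_1
  try simp only [Nat.reduceAdd, Nat.reduceMul, Nat.reducePow, Nat.cast_one, Nat.cast_ofNat, Finset.sum_range_succ, Finset.sum_range_zero, zero_add, Function.iterate_zero, id_eq, iterate_dθ_one, iterate_dθ_two] at hlow0_13 hlow1_13
  have res13 : (∫ p in strip, radialWeight p.1 ^ 2 * (dθ^[3] (Dz^[3] Ψ)) p.1 p.2 ^ 2 * Real.sin (2 * p.2) ^ (2 - gammaExp α)) +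
      (∫ p in strip, radialWeight p.1 ^ 2 * dθ (dθ (Dz^[3] χ)) p.1 p.2 ^ 2 * Real.sin (2 * p.2) ^ (2 - gammaExp α)) ≤
      200000000 * D := by
    linarith only [hLev13, hDat13, hT0_13, hT1_13, aT2_13, aT2'_13, aT1_13, hY3, hY4, hZ4, nnT2_13, nnZ_13, nnT1_13, hlow0_13, hlow1_13, hB3, hC3, dF13, hD0, dL0, dL1, dL2, dL3, dL4]
  ----------------------------------------------------------------
  -- level (2, 0)
  ----------------------------------------------------------------
  have hLev20 := angular_level_estimate 2 (r := 4 - gammaExp α) hr0_2 hr1_2 hWc hW0 (regχj 2 0 (by norm_num)) (hsj 0) (hposj 0) (hΨj 0 (by norm_num))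
  try simp only [Nat.reduceAdd, Nat.reduceMul, Nat.reducePow, Nat.cast_one, Nat.cast_ofNat, Finset.sum_range_succ, Finset.sum_range_zero, zero_add, Function.iterate_zero, id_eq, iterate_dθ_one, iterate_dθ_two] at hLev20
  have hDat20 := angular_data_bound α 2 0 hr0_2 hWc hW0 (regχd 2 0 (by norm_num)) hs hpos hΨ hgF
  try simp only [Nat.reduceAdd, Nat.reduceMul, Nat.reducePow, Nat.cast_one, Nat.cast_ofNat, Finset.sum_range_succ, Finset.sum_range_zero, zero_add, Function.iterate_zero, id_eq, iterate_dθ_one, iterate_dθ_two] at hDat20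
  have hT0_20 := integral_weight_rpow_le_singular hWc hW0 (cΨ 2 0 (by norm_num)) (sΨ 2 0) (pΨ 2 0) hr0_2
  have hT1_20 := integral_weight_rpow_le_singular hWc hW0 (cΨ 2 1 (by norm_num)) (sΨ 2 1) (pΨ 2 1) hr0_2
  have hT2_20 := integral_weight_rpow_le_singular hWc hW0 (cΨ 2 2 (by norm_num)) (sΨ 2 2) (pΨ 2 2) hr0_2
  try simp only [Nat.reduceAdd, Nat.reduceMul, Nat.reducePow, Nat.cast_one, Nat.cast_ofNat, Finset.sum_range_succ, Finset.sum_range_zero, zero_add, Function.iterate_zero, id_eq, iterate_dθ_one, iterate_dθ_two] at hT0_20 hT1_20 hT2_20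
  have nnT0_20 : 0 ≤ ∫ p in strip, radialWeight p.1 ^ 2 * dθ (dθ Ψ) p.1 p.2 ^ 2 * Real.sin (2 * p.2) ^ (4 - gammaExp α) :=
    setIntegral_nonneg measurableSet_strip fun p hp => strip_integrand_nonneg hp _ _
  have nnT1_20 : 0 ≤ ∫ p in strip, radialWeight p.1 ^ 2 * dθ (dθ (Dz^[1] Ψ)) p.1 p.2 ^ 2 * Real.sin (2 * p.2) ^ (4 - gammaExp α) :=
    setIntegral_nonneg measurableSet_strip fun p hp => strip_integrand_nonneg hp _ _
  have nnT2_20 : 0 ≤ ∫ p in strip, radialWeight p.1 ^ 2 * dθ (dθ (Dz^[2] Ψ)) p.1 p.2 ^ 2 * Real.sin (2 * p.2) ^ (4 - gammaExp α) :=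
    setIntegral_nonneg measurableSet_strip fun p hp => strip_integrand_nonneg hp _ _
  have aT2_20 : α ^ 4 * (∫ p in strip, radialWeight p.1 ^ 2 * dθ (dθ (Dz^[2] Ψ)) p.1 p.2 ^ 2 * Real.sin (2 * p.2) ^ (4 - gammaExp α)) ≤
      1 * ∫ p in strip, radialWeight p.1 ^ 2 * dθ (dθ (Dz^[2] Ψ)) p.1 p.2 ^ 2 * Real.sin (2 * p.2) ^ (4 - gammaExp α) := mul_le_mul_of_nonneg_right hα4' nnT2_20
  have aT1_20 : α ^ 2 * (∫ p in strip, radialWeight p.1 ^ 2 * dθ (dθ (Dz^[1] Ψ)) p.1 p.2 ^ 2 * Real.sin (2 * p.2) ^ (4 - gammaExp α)) ≤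
      1 * ∫ p in strip, radialWeight p.1 ^ 2 * dθ (dθ (Dz^[1] Ψ)) p.1 p.2 ^ 2 * Real.sin (2 * p.2) ^ (4 - gammaExp α) := mul_le_mul_of_nonneg_right hα2 nnT1_20
  have hlow0_20 := integral_weight_rpow_le_singular hWc hW0 (cχ 0 0 (by norm_num)) (sχ 0 0) (pχ 0 0) hr0_2
  have hlow1_20 := integral_weight_rpow_le_singular hWc hW0 (cχ 1 0 (by norm_num)) (sχ 1 0) (pχ 1 0) hr0_2
  try simp only [Nat.reduceAdd, Nat.reduceMul, Nat.reducePow, Nat.cast_one, Nat.cast_ofNat, Finset.sum_range_succ, Finset.sum_range_zero, zero_add, Function.iterate_zero, id_eq, iterate_dθ_one, iterate_dθ_two] at hlow0_20 hlow1_20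
  have hlow2_20 := integral_weight_rpow_mono hWc hW0 (cχ 2 0 (by norm_num)) (sχ 2 0) (pχ 2 0) (r := 2 - gammaExp α) (r' := 4 - gammaExp α) hr0_1 (by linarith)
  try simp only [Nat.reduceAdd, Nat.reduceMul, Nat.reducePow, Nat.cast_one, Nat.cast_ofNat, Finset.sum_range_succ, Finset.sum_range_zero, zero_add, Function.iterate_zero, id_eq, iterate_dθ_one, iterate_dθ_two] at hlow2_20
  have nnM10_20 : 0 ≤ (∫ p in strip, radialWeight p.1 ^ 2 * (dθ^[3] Ψ) p.1 p.2 ^ 2 * Real.sin (2 * p.2) ^ (2 - gammaExp α)) := setIntegral_nonneg measurableSet_strip fun p hp => strip_integrand_nonneg hp _ _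
  have res20 : (∫ p in strip, radialWeight p.1 ^ 2 * (dθ^[4] Ψ) p.1 p.2 ^ 2 * Real.sin (2 * p.2) ^ (4 - gammaExp α)) +
      (∫ p in strip, radialWeight p.1 ^ 2 * (dθ^[3] χ) p.1 p.2 ^ 2 * Real.sin (2 * p.2) ^ (4 - gammaExp α)) ≤
      3000000000000 * D := by
    linarith only [hLev20, hDat20, hT0_20, hT1_20, hT2_20, aT2_20, aT1_20, hP0, hP1, hP2, nnT0_20, nnT1_20, nnT2_20, hlow0_20, hlow1_20, hB0, hC0, hlow2_20, res10, nnM10_20, dF20, hD0, dL0, dL1, dL2, dL3, dL4]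
  ----------------------------------------------------------------
  -- level (2, 1)
  ----------------------------------------------------------------
  have hLev21 := angular_level_estimate 2 (r := 4 - gammaExp α) hr0_2 hr1_2 hWc hW0 (regχj 2 1 (by norm_num)) (hsj 1) (hposj 1) (hΨj 1 (by norm_num))
  try simp only [Nat.reduceAdd, Nat.reduceMul, Nat.reducePow, Nat.cast_one, Nat.cast_ofNat, Finset.sum_range_succ, Finset.sum_range_zero, zero_add, Function.iterate_zero, id_eq, iterate_dθ_one, iterate_dθ_two] at hLev21
  have hDat21 := angular_data_bound α 2 1 hr0_2 hWc hW0 (regχd 2 1 (by norm_num)) hs hpos hΨ hgF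
  try simp only [Nat.reduceAdd, Nat.reduceMul, Nat.reducePow, Nat.cast_one, Nat.cast_ofNat, Finset.sum_range_succ, Finset.sum_range_zero, zero_add, Function.iterate_zero, id_eq, iterate_dθ_one, iterate_dθ_two] at hDat21
  have hT0_21 := integral_weight_rpow_le_singular hWc hW0 (cΨ 2 1 (by norm_num)) (sΨ 2 1) (pΨ 2 1) hr0_2
  have hT1_21 := integral_weight_rpow_le_singular hWc hW0 (cΨ 2 2 (by norm_num)) (sΨ 2 2) (pΨ 2 2) hr0_2
  have hT2_21 := integral_weight_rpow_le_singular hWc hW0 (cΨ 2 3 (by norm_num)) (sΨ 2 3) (pΨ 2 3) hr0_2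
  try simp only [Nat.reduceAdd, Nat.reduceMul, Nat.reducePow, Nat.cast_one, Nat.cast_ofNat, Finset.sum_range_succ, Finset.sum_range_zero, zero_add, Function.iterate_zero, id_eq, iterate_dθ_one, iterate_dθ_two] at hT0_21 hT1_21 hT2_21
  have nnT0_21 : 0 ≤ ∫ p in strip, radialWeight p.1 ^ 2 * dθ (dθ (Dz^[1] Ψ)) p.1 p.2 ^ 2 * Real.sin (2 * p.2) ^ (4 - gammaExp α) :=
    setIntegral_nonneg measurableSet_strip fun p hp => strip_integrand_nonneg hp _ _
  have nnT1_21 : 0 ≤ ∫ p in strip, radialWeight p.1 ^ 2 * dθ (dθ (Dz^[2] Ψ)) p.1 p.2 ^ 2 * Real.sin (2 * p.2) ^ (4 - gammaExp α) :=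
    setIntegral_nonneg measurableSet_strip fun p hp => strip_integrand_nonneg hp _ _
  have nnT2_21 : 0 ≤ ∫ p in strip, radialWeight p.1 ^ 2 * dθ (dθ (Dz^[3] Ψ)) p.1 p.2 ^ 2 * Real.sin (2 * p.2) ^ (4 - gammaExp α) :=
    setIntegral_nonneg measurableSet_strip fun p hp => strip_integrand_nonneg hp _ _
  have aT2_21 : α ^ 4 * (∫ p in strip, radialWeight p.1 ^ 2 * dθ (dθ (Dz^[3] Ψ)) p.1 p.2 ^ 2 * Real.sin (2 * p.2) ^ (4 - gammaExp α)) ≤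
      1 * ∫ p in strip, radialWeight p.1 ^ 2 * dθ (dθ (Dz^[3] Ψ)) p.1 p.2 ^ 2 * Real.sin (2 * p.2) ^ (4 - gammaExp α) := mul_le_mul_of_nonneg_right hα4' nnT2_21
  have aT1_21 : α ^ 2 * (∫ p in strip, radialWeight p.1 ^ 2 * dθ (dθ (Dz^[2] Ψ)) p.1 p.2 ^ 2 * Real.sin (2 * p.2) ^ (4 - gammaExp α)) ≤
      1 * ∫ p in strip, radialWeight p.1 ^ 2 * dθ (dθ (Dz^[2] Ψ)) p.1 p.2 ^ 2 * Real.sin (2 * p.2) ^ (4 - gammaExp α) := mul_le_mul_of_nonneg_right hα2 nnT1_21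
  have hlow0_21 := integral_weight_rpow_le_singular hWc hW0 (cχ 0 1 (by norm_num)) (sχ 0 1) (pχ 0 1) hr0_2
  have hlow1_21 := integral_weight_rpow_le_singular hWc hW0 (cχ 1 1 (by norm_num)) (sχ 1 1) (pχ 1 1) hr0_2
  try simp only [Nat.reduceAdd, Nat.reduceMul, Nat.reducePow, Nat.cast_one, Nat.cast_ofNat, Finset.sum_range_succ, Finset.sum_range_zero, zero_add, Function.iterate_zero, id_eq, iterate_dθ_one, iterate_dθ_two] at hlow0_21 hlow1_21
  have hlow2_21 := integral_weight_rpow_mono hWc hW0 (cχ 2 1 (by norm_num)) (sχ 2 1) (pχ 2 1) (r := 2 - gammaExp α) (r' := 4 - gammaExp α) hr0_1 (by linarith)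
  try simp only [Nat.reduceAdd, Nat.reduceMul, Nat.reducePow, Nat.cast_one, Nat.cast_ofNat, Finset.sum_range_succ, Finset.sum_range_zero, zero_add, Function.iterate_zero, id_eq, iterate_dθ_one, iterate_dθ_two] at hlow2_21
  have nnM11_21 : 0 ≤ (∫ p in strip, radialWeight p.1 ^ 2 * (dθ^[3] (Dz^[1] Ψ)) p.1 p.2 ^ 2 * Real.sin (2 * p.2) ^ (2 - gammaExp α)) := setIntegral_nonneg measurableSet_strip fun p hp => strip_integrand_nonneg hp _ _
  have res21 : (∫ p in strip, radialWeight p.1 ^ 2 * (dθ^[4] (Dz^[1] Ψ)) p.1 p.2 ^ 2 * Real.sin (2 * p.2) ^ (4 - gammaExp α)) +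
      (∫ p in strip, radialWeight p.1 ^ 2 * (dθ^[3] (Dz^[1] χ)) p.1 p.2 ^ 2 * Real.sin (2 * p.2) ^ (4 - gammaExp α)) ≤
      3000000000000 * D := by
    linarith only [hLev21, hDat21, hT0_21, hT1_21, hT2_21, aT2_21, aT1_21, hP1, hP2, hP3, nnT0_21, nnT1_21, nnT2_21, hlow0_21, hlow1_21, hB1, hC1, hlow2_21, res11, nnM11_21, dF21, hD0, dL0, dL1, dL2, dL3, dL4]
  ----------------------------------------------------------------
  -- level (2, 2)
  ----------------------------------------------------------------
  have hLev22 := angular_level_estimate 2 (r := 4 - gammaExp α) hr0_2 hr1_2 hWc hW0 (regχj 2 2 (by norm_num)) (hsj 2) (hposj 2) (hΨj 2 (by norm_num))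
  try simp only [Nat.reduceAdd, Nat.reduceMul, Nat.reducePow, Nat.cast_one, Nat.cast_ofNat, Finset.sum_range_succ, Finset.sum_range_zero, zero_add, Function.iterate_zero, id_eq, iterate_dθ_one, iterate_dθ_two] at hLev22
  have hDat22 := angular_data_bound α 2 2 hr0_2 hWc hW0 (regχd 2 2 (by norm_num)) hs hpos hΨ hgF
  try simp only [Nat.reduceAdd, Nat.reduceMul, Nat.reducePow, Nat.cast_one, Nat.cast_ofNat, Finset.sum_range_succ, Finset.sum_range_zero, zero_add, Function.iterate_zero, id_eq, iterate_dθ_one, iterate_dθ_two] at hDat22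
  have hT0_22 := integral_weight_rpow_le_singular hWc hW0 (cΨ 2 2 (by norm_num)) (sΨ 2 2) (pΨ 2 2) hr0_2
  have hT1_22 := integral_weight_rpow_le_singular hWc hW0 (cΨ 2 3 (by norm_num)) (sΨ 2 3) (pΨ 2 3) hr0_2
  have hT2_22 := integral_weight_rpow_le_singular hWc hW0 (cΨ 2 4 (by norm_num)) (sΨ 2 4) (pΨ 2 4) hr0_2
  try simp only [Nat.reduceAdd, Nat.reduceMul, Nat.reducePow, Nat.cast_one, Nat.cast_ofNat, Finset.sum_range_succ, Finset.sum_range_zero, zero_add, Function.iterate_zero, id_eq, iterate_dθ_one, iterate_dθ_two] at hT0_22 hT1_22 hT2_22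
  have nnT0_22 : 0 ≤ ∫ p in strip, radialWeight p.1 ^ 2 * dθ (dθ (Dz^[2] Ψ)) p.1 p.2 ^ 2 * Real.sin (2 * p.2) ^ (4 - gammaExp α) :=
    setIntegral_nonneg measurableSet_strip fun p hp => strip_integrand_nonneg hp _ _
  have nnT1_22 : 0 ≤ ∫ p in strip, radialWeight p.1 ^ 2 * dθ (dθ (Dz^[3] Ψ)) p.1 p.2 ^ 2 * Real.sin (2 * p.2) ^ (4 - gammaExp α) :=
    setIntegral_nonneg measurableSet_strip fun p hp => strip_integrand_nonneg hp _ _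
  have nnT2_22 : 0 ≤ ∫ p in strip, radialWeight p.1 ^ 2 * dθ (dθ (Dz^[4] Ψ)) p.1 p.2 ^ 2 * Real.sin (2 * p.2) ^ (4 - gammaExp α) :=
    setIntegral_nonneg measurableSet_strip fun p hp => strip_integrand_nonneg hp _ _
  have aT2_22 : α ^ 4 * (∫ p in strip, radialWeight p.1 ^ 2 * dθ (dθ (Dz^[4] Ψ)) p.1 p.2 ^ 2 * Real.sin (2 * p.2) ^ (4 - gammaExp α)) ≤
      1 * ∫ p in strip, radialWeight p.1 ^ 2 * dθ (dθ (Dz^[4] Ψ)) p.1 p.2 ^ 2 * Real.sin (2 * p.2) ^ (4 - gammaExp α) := mul_le_mul_of_nonneg_right hα4' nnT2_22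
  have aT1_22 : α ^ 2 * (∫ p in strip, radialWeight p.1 ^ 2 * dθ (dθ (Dz^[3] Ψ)) p.1 p.2 ^ 2 * Real.sin (2 * p.2) ^ (4 - gammaExp α)) ≤
      1 * ∫ p in strip, radialWeight p.1 ^ 2 * dθ (dθ (Dz^[3] Ψ)) p.1 p.2 ^ 2 * Real.sin (2 * p.2) ^ (4 - gammaExp α) := mul_le_mul_of_nonneg_right hα2 nnT1_22
  have hlow0_22 := integral_weight_rpow_le_singular hWc hW0 (cχ 0 2 (by norm_num)) (sχ 0 2) (pχ 0 2) hr0_2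
  have hlow1_22 := integral_weight_rpow_le_singular hWc hW0 (cχ 1 2 (by norm_num)) (sχ 1 2) (pχ 1 2) hr0_2
  try simp only [Nat.reduceAdd, Nat.reduceMul, Nat.reducePow, Nat.cast_one, Nat.cast_ofNat, Finset.sum_range_succ, Finset.sum_range_zero, zero_add, Function.iterate_zero, id_eq, iterate_dθ_one, iterate_dθ_two] at hlow0_22 hlow1_22
  have hlow2_22 := integral_weight_rpow_mono hWc hW0 (cχ 2 2 (by norm_num)) (sχ 2 2) (pχ 2 2) (r := 2 - gammaExp α) (r' := 4 - gammaExp α) hr0_1 (by linarith)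
  try simp only [Nat.reduceAdd, Nat.reduceMul, Nat.reducePow, Nat.cast_one, Nat.cast_ofNat, Finset.sum_range_succ, Finset.sum_range_zero, zero_add, Function.iterate_zero, id_eq, iterate_dθ_one, iterate_dθ_two] at hlow2_22
  have nnM12_22 : 0 ≤ (∫ p in strip, radialWeight p.1 ^ 2 * (dθ^[3] (Dz^[2] Ψ)) p.1 p.2 ^ 2 * Real.sin (2 * p.2) ^ (2 - gammaExp α)) := setIntegral_nonneg measurableSet_strip fun p hp => strip_integrand_nonneg hp _ _
  have res22 : (∫ p in strip, radialWeight p.1 ^ 2 * (dθ^[4] (Dz^[2] Ψ)) p.1 p.2 ^ 2 * Real.sin (2 * p.2) ^ (4 - gammaExp α)) +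
      (∫ p in strip, radialWeight p.1 ^ 2 * (dθ^[3] (Dz^[2] χ)) p.1 p.2 ^ 2 * Real.sin (2 * p.2) ^ (4 - gammaExp α)) ≤
      3000000000000 * D := by
    linarith only [hLev22, hDat22, hT0_22, hT1_22, hT2_22, aT2_22, aT1_22, hP2, hP3, hP4, nnT0_22, nnT1_22, nnT2_22, hlow0_22, hlow1_22, hB2, hC2, hlow2_22, res12, nnM12_22, dF22, hD0, dL0, dL1, dL2, dL3, dL4]
  ----------------------------------------------------------------
  -- level (3, 0)
  ----------------------------------------------------------------
  have hLev30 := angular_level_estimate 3 (r := 6 - gammaExp α) hr0_3 hr1_3 hWc hW0 (regχj 3 0 (by norm_num)) (hsj 0) (hposj 0) (hΨj 0 (by norm_num))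
  try simp only [Nat.reduceAdd, Nat.reduceMul, Nat.reducePow, Nat.cast_one, Nat.cast_ofNat, Finset.sum_range_succ, Finset.sum_range_zero, zero_add, Function.iterate_zero, id_eq, iterate_dθ_one, iterate_dθ_two] at hLev30
  have hDat30 := angular_data_bound α 3 0 hr0_3 hWc hW0 (regχd 3 0 (by norm_num)) hs hpos hΨ hgF
  try simp only [Nat.reduceAdd, Nat.reduceMul, Nat.reducePow, Nat.cast_one, Nat.cast_ofNat, Finset.sum_range_succ, Finset.sum_range_zero, zero_add, Function.iterate_zero, id_eq, iterate_dθ_one, iterate_dθ_two] at hDat30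
  have hT0_30 := integral_weight_rpow_mono hWc hW0 (cΨ 3 0 (by norm_num)) (sΨ 3 0) (pΨ 3 0) (r := 2 - gammaExp α) (r' := 6 - gammaExp α) hr0_1 (by linarith)
  try simp only [Nat.reduceAdd, Nat.reduceMul, Nat.reducePow, Nat.cast_one, Nat.cast_ofNat, Finset.sum_range_succ, Finset.sum_range_zero, zero_add, Function.iterate_zero, id_eq, iterate_dθ_one, iterate_dθ_two] at hT0_30
  have nnT0_30 : 0 ≤ ∫ p in strip, radialWeight p.1 ^ 2 * (dθ^[3] Ψ) p.1 p.2 ^ 2 * Real.sin (2 * p.2) ^ (6 - gammaExp α) :=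
    setIntegral_nonneg measurableSet_strip fun p hp => strip_integrand_nonneg hp _ _
  have hT1_30 := integral_weight_rpow_mono hWc hW0 (cΨ 3 1 (by norm_num)) (sΨ 3 1) (pΨ 3 1) (r := 2 - gammaExp α) (r' := 6 - gammaExp α) hr0_1 (by linarith)
  try simp only [Nat.reduceAdd, Nat.reduceMul, Nat.reducePow, Nat.cast_one, Nat.cast_ofNat, Finset.sum_range_succ, Finset.sum_range_zero, zero_add, Function.iterate_zero, id_eq, iterate_dθ_one, iterate_dθ_two] at hT1_30
  have nnT1_30 : 0 ≤ ∫ p in strip, radialWeight p.1 ^ 2 * (dθ^[3] (Dz^[1] Ψ)) p.1 p.2 ^ 2 * Real.sin (2 * p.2) ^ (6 - gammaExp α) :=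
    setIntegral_nonneg measurableSet_strip fun p hp => strip_integrand_nonneg hp _ _
  have hT2_30 := integral_weight_rpow_mono hWc hW0 (cΨ 3 2 (by norm_num)) (sΨ 3 2) (pΨ 3 2) (r := 2 - gammaExp α) (r' := 6 - gammaExp α) hr0_1 (by linarith)
  try simp only [Nat.reduceAdd, Nat.reduceMul, Nat.reducePow, Nat.cast_one, Nat.cast_ofNat, Finset.sum_range_succ, Finset.sum_range_zero, zero_add, Function.iterate_zero, id_eq, iterate_dθ_one, iterate_dθ_two] at hT2_30
  have nnT2_30 : 0 ≤ ∫ p in strip, radialWeight p.1 ^ 2 * (dθ^[3] (Dz^[2] Ψ)) p.1 p.2 ^ 2 * Real.sin (2 * p.2) ^ (6 - gammaExp α) :=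
    setIntegral_nonneg measurableSet_strip fun p hp => strip_integrand_nonneg hp _ _
  have aT2_30 : α ^ 4 * (∫ p in strip, radialWeight p.1 ^ 2 * (dθ^[3] (Dz^[2] Ψ)) p.1 p.2 ^ 2 * Real.sin (2 * p.2) ^ (6 - gammaExp α)) ≤
      1 * ∫ p in strip, radialWeight p.1 ^ 2 * (dθ^[3] (Dz^[2] Ψ)) p.1 p.2 ^ 2 * Real.sin (2 * p.2) ^ (6 - gammaExp α) := mul_le_mul_of_nonneg_right hα4' nnT2_30
  have aT1_30 : α ^ 2 * (∫ p in strip, radialWeight p.1 ^ 2 * (dθ^[3] (Dz^[1] Ψ)) p.1 p.2 ^ 2 * Real.sin (2 * p.2) ^ (6 - gammaExp α)) ≤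
      1 * ∫ p in strip, radialWeight p.1 ^ 2 * (dθ^[3] (Dz^[1] Ψ)) p.1 p.2 ^ 2 * Real.sin (2 * p.2) ^ (6 - gammaExp α) := mul_le_mul_of_nonneg_right hα2 nnT1_30
  have nnN10_30 : 0 ≤ (∫ p in strip, radialWeight p.1 ^ 2 * dθ (dθ χ) p.1 p.2 ^ 2 * Real.sin (2 * p.2) ^ (2 - gammaExp α)) := setIntegral_nonneg measurableSet_strip fun p hp => strip_integrand_nonneg hp _ _
  have nnN11_30 : 0 ≤ (∫ p in strip, radialWeight p.1 ^ 2 * dθ (dθ (Dz^[1] χ)) p.1 p.2 ^ 2 * Real.sin (2 * p.2) ^ (2 - gammaExp α)) := setIntegral_nonneg measurableSet_strip fun p hp => strip_integrand_nonneg hp _ _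
  have nnN12_30 : 0 ≤ (∫ p in strip, radialWeight p.1 ^ 2 * dθ (dθ (Dz^[2] χ)) p.1 p.2 ^ 2 * Real.sin (2 * p.2) ^ (2 - gammaExp α)) := setIntegral_nonneg measurableSet_strip fun p hp => strip_integrand_nonneg hp _ _
  have hlow0_30 := integral_weight_rpow_le_singular hWc hW0 (cχ 0 0 (by norm_num)) (sχ 0 0) (pχ 0 0) hr0_3
  have hlow1_30 := integral_weight_rpow_le_singular hWc hW0 (cχ 1 0 (by norm_num)) (sχ 1 0) (pχ 1 0) hr0_3
  try simp only [Nat.reduceAdd, Nat.reduceMul, Nat.reducePow, Nat.cast_one, Nat.cast_ofNat, Finset.sum_range_succ, Finset.sum_range_zero, zero_add, Function.iterate_zero, id_eq, iterate_dθ_one, iterate_dθ_two] at hlow0_30 hlow1_30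
  have hlow2_30 := integral_weight_rpow_mono hWc hW0 (cχ 2 0 (by norm_num)) (sχ 2 0) (pχ 2 0) (r := 2 - gammaExp α) (r' := 6 - gammaExp α) hr0_1 (by linarith)
  try simp only [Nat.reduceAdd, Nat.reduceMul, Nat.reducePow, Nat.cast_one, Nat.cast_ofNat, Finset.sum_range_succ, Finset.sum_range_zero, zero_add, Function.iterate_zero, id_eq, iterate_dθ_one, iterate_dθ_two] at hlow2_30
  have nnM10_30 : 0 ≤ (∫ p in strip, radialWeight p.1 ^ 2 * (dθ^[3] Ψ) p.1 p.2 ^ 2 * Real.sin (2 * p.2) ^ (2 - gammaExp α)) := setIntegral_nonneg measurableSet_strip fun p hp => strip_integrand_nonneg hp _ _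
  have hlow3_30 := integral_weight_rpow_mono hWc hW0 (cχ 3 0 (by norm_num)) (sχ 3 0) (pχ 3 0) (r := 4 - gammaExp α) (r' := 6 - gammaExp α) hr0_2 (by linarith)
  try simp only [Nat.reduceAdd, Nat.reduceMul, Nat.reducePow, Nat.cast_one, Nat.cast_ofNat, Finset.sum_range_succ, Finset.sum_range_zero, zero_add, Function.iterate_zero, id_eq, iterate_dθ_one, iterate_dθ_two] at hlow3_30
  have nnM20_30 : 0 ≤ (∫ p in strip, radialWeight p.1 ^ 2 * (dθ^[4] Ψ) p.1 p.2 ^ 2 * Real.sin (2 * p.2) ^ (4 - gammaExp α)) := setIntegral_nonneg measurableSet_strip fun p hp => strip_integrand_nonneg hp _ _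
  have res30 : (∫ p in strip, radialWeight p.1 ^ 2 * (dθ^[5] Ψ) p.1 p.2 ^ 2 * Real.sin (2 * p.2) ^ (6 - gammaExp α)) +
      (∫ p in strip, radialWeight p.1 ^ 2 * (dθ^[4] χ) p.1 p.2 ^ 2 * Real.sin (2 * p.2) ^ (6 - gammaExp α)) ≤
      200000000000000000 * D := by
    linarith only [hLev30, hDat30, hT0_30, hT1_30, hT2_30, aT2_30, aT1_30, nnT0_30, nnT1_30, nnT2_30, res10, res11, res12, nnN10_30, nnN11_30, nnN12_30, hlow0_30, hlow1_30, hB0, hC0, hlow2_30, res10, nnM10_30, hlow3_30, res20, nnM20_30, dF30, hD0, dL0, dL1, dL2, dL3, dL4]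
  ----------------------------------------------------------------
  -- level (3, 1)
  ----------------------------------------------------------------
  have hLev31 := angular_level_estimate 3 (r := 6 - gammaExp α) hr0_3 hr1_3 hWc hW0 (regχj 3 1 (by norm_num)) (hsj 1) (hposj 1) (hΨj 1 (by norm_num))
  try simp only [Nat.reduceAdd, Nat.reduceMul, Nat.reducePow, Nat.cast_one, Nat.cast_ofNat, Finset.sum_range_succ, Finset.sum_range_zero, zero_add, Function.iterate_zero, id_eq, iterate_dθ_one, iterate_dθ_two] at hLev31
  have hDat31 := angular_data_bound α 3 1 hr0_3 hWc hW0 (regχd 3 1 (by norm_num)) hs hpos hΨ hgF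
  try simp only [Nat.reduceAdd, Nat.reduceMul, Nat.reducePow, Nat.cast_one, Nat.cast_ofNat, Finset.sum_range_succ, Finset.sum_range_zero, zero_add, Function.iterate_zero, id_eq, iterate_dθ_one, iterate_dθ_two] at hDat31
  have hT0_31 := integral_weight_rpow_mono hWc hW0 (cΨ 3 1 (by norm_num)) (sΨ 3 1) (pΨ 3 1) (r := 2 - gammaExp α) (r' := 6 - gammaExp α) hr0_1 (by linarith)
  try simp only [Nat.reduceAdd, Nat.reduceMul, Nat.reducePow, Nat.cast_one, Nat.cast_ofNat, Finset.sum_range_succ, Finset.sum_range_zero, zero_add, Function.iterate_zero, id_eq, iterate_dθ_one, iterate_dθ_two] at hT0_31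
  have nnT0_31 : 0 ≤ ∫ p in strip, radialWeight p.1 ^ 2 * (dθ^[3] (Dz^[1] Ψ)) p.1 p.2 ^ 2 * Real.sin (2 * p.2) ^ (6 - gammaExp α) :=
    setIntegral_nonneg measurableSet_strip fun p hp => strip_integrand_nonneg hp _ _
  have hT1_31 := integral_weight_rpow_mono hWc hW0 (cΨ 3 2 (by norm_num)) (sΨ 3 2) (pΨ 3 2) (r := 2 - gammaExp α) (r' := 6 - gammaExp α) hr0_1 (by linarith)
  try simp only [Nat.reduceAdd, Nat.reduceMul, Nat.reducePow, Nat.cast_one, Nat.cast_ofNat, Finset.sum_range_succ, Finset.sum_range_zero, zero_add, Function.iterate_zero, id_eq, iterate_dθ_one, iterate_dθ_two] at hT1_31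
  have nnT1_31 : 0 ≤ ∫ p in strip, radialWeight p.1 ^ 2 * (dθ^[3] (Dz^[2] Ψ)) p.1 p.2 ^ 2 * Real.sin (2 * p.2) ^ (6 - gammaExp α) :=
    setIntegral_nonneg measurableSet_strip fun p hp => strip_integrand_nonneg hp _ _
  have hT2_31 := integral_weight_rpow_mono hWc hW0 (cΨ 3 3 (by norm_num)) (sΨ 3 3) (pΨ 3 3) (r := 2 - gammaExp α) (r' := 6 - gammaExp α) hr0_1 (by linarith)
  try simp only [Nat.reduceAdd, Nat.reduceMul, Nat.reducePow, Nat.cast_one, Nat.cast_ofNat, Finset.sum_range_succ, Finset.sum_range_zero, zero_add, Function.iterate_zero, id_eq, iterate_dθ_one, iterate_dθ_two] at hT2_31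
  have nnT2_31 : 0 ≤ ∫ p in strip, radialWeight p.1 ^ 2 * (dθ^[3] (Dz^[3] Ψ)) p.1 p.2 ^ 2 * Real.sin (2 * p.2) ^ (6 - gammaExp α) :=
    setIntegral_nonneg measurableSet_strip fun p hp => strip_integrand_nonneg hp _ _
  have aT2_31 : α ^ 4 * (∫ p in strip, radialWeight p.1 ^ 2 * (dθ^[3] (Dz^[3] Ψ)) p.1 p.2 ^ 2 * Real.sin (2 * p.2) ^ (6 - gammaExp α)) ≤
      1 * ∫ p in strip, radialWeight p.1 ^ 2 * (dθ^[3] (Dz^[3] Ψ)) p.1 p.2 ^ 2 * Real.sin (2 * p.2) ^ (6 - gammaExp α) := mul_le_mul_of_nonneg_right hα4' nnT2_31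
  have aT1_31 : α ^ 2 * (∫ p in strip, radialWeight p.1 ^ 2 * (dθ^[3] (Dz^[2] Ψ)) p.1 p.2 ^ 2 * Real.sin (2 * p.2) ^ (6 - gammaExp α)) ≤
      1 * ∫ p in strip, radialWeight p.1 ^ 2 * (dθ^[3] (Dz^[2] Ψ)) p.1 p.2 ^ 2 * Real.sin (2 * p.2) ^ (6 - gammaExp α) := mul_le_mul_of_nonneg_right hα2 nnT1_31
  have nnN11_31 : 0 ≤ (∫ p in strip, radialWeight p.1 ^ 2 * dθ (dθ (Dz^[1] χ)) p.1 p.2 ^ 2 * Real.sin (2 * p.2) ^ (2 - gammaExp α)) := setIntegral_nonneg measurableSet_strip fun p hp => strip_integrand_nonneg hp _ _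
  have nnN12_31 : 0 ≤ (∫ p in strip, radialWeight p.1 ^ 2 * dθ (dθ (Dz^[2] χ)) p.1 p.2 ^ 2 * Real.sin (2 * p.2) ^ (2 - gammaExp α)) := setIntegral_nonneg measurableSet_strip fun p hp => strip_integrand_nonneg hp _ _
  have nnN13_31 : 0 ≤ (∫ p in strip, radialWeight p.1 ^ 2 * dθ (dθ (Dz^[3] χ)) p.1 p.2 ^ 2 * Real.sin (2 * p.2) ^ (2 - gammaExp α)) := setIntegral_nonneg measurableSet_strip fun p hp => strip_integrand_nonneg hp _ _
  have hlow0_31 := integral_weight_rpow_le_singular hWc hW0 (cχ 0 1 (by norm_num)) (sχ 0 1) (pχ 0 1) hr0_3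
  have hlow1_31 := integral_weight_rpow_le_singular hWc hW0 (cχ 1 1 (by norm_num)) (sχ 1 1) (pχ 1 1) hr0_3
  try simp only [Nat.reduceAdd, Nat.reduceMul, Nat.reducePow, Nat.cast_one, Nat.cast_ofNat, Finset.sum_range_succ, Finset.sum_range_zero, zero_add, Function.iterate_zero, id_eq, iterate_dθ_one, iterate_dθ_two] at hlow0_31 hlow1_31
  have hlow2_31 := integral_weight_rpow_mono hWc hW0 (cχ 2 1 (by norm_num)) (sχ 2 1) (pχ 2 1) (r := 2 - gammaExp α) (r' := 6 - gammaExp α) hr0_1 (by linarith)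
  try simp only [Nat.reduceAdd, Nat.reduceMul, Nat.reducePow, Nat.cast_one, Nat.cast_ofNat, Finset.sum_range_succ, Finset.sum_range_zero, zero_add, Function.iterate_zero, id_eq, iterate_dθ_one, iterate_dθ_two] at hlow2_31
  have nnM11_31 : 0 ≤ (∫ p in strip, radialWeight p.1 ^ 2 * (dθ^[3] (Dz^[1] Ψ)) p.1 p.2 ^ 2 * Real.sin (2 * p.2) ^ (2 - gammaExp α)) := setIntegral_nonneg measurableSet_strip fun p hp => strip_integrand_nonneg hp _ _
  have hlow3_31 := integral_weight_rpow_mono hWc hW0 (cχ 3 1 (by norm_num)) (sχ 3 1) (pχ 3 1) (r := 4 - gammaExp α) (r' := 6 - gammaExp α) hr0_2 (by linarith)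
  try simp only [Nat.reduceAdd, Nat.reduceMul, Nat.reducePow, Nat.cast_one, Nat.cast_ofNat, Finset.sum_range_succ, Finset.sum_range_zero, zero_add, Function.iterate_zero, id_eq, iterate_dθ_one, iterate_dθ_two] at hlow3_31
  have nnM21_31 : 0 ≤ (∫ p in strip, radialWeight p.1 ^ 2 * (dθ^[4] (Dz^[1] Ψ)) p.1 p.2 ^ 2 * Real.sin (2 * p.2) ^ (4 - gammaExp α)) := setIntegral_nonneg measurableSet_strip fun p hp => strip_integrand_nonneg hp _ _
  have res31 : (∫ p in strip, radialWeight p.1 ^ 2 * (dθ^[5] (Dz^[1] Ψ)) p.1 p.2 ^ 2 * Real.sin (2 * p.2) ^ (6 - gammaExp α)) +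
      (∫ p in strip, radialWeight p.1 ^ 2 * (dθ^[4] (Dz^[1] χ)) p.1 p.2 ^ 2 * Real.sin (2 * p.2) ^ (6 - gammaExp α)) ≤
      200000000000000000 * D := by
    linarith only [hLev31, hDat31, hT0_31, hT1_31, hT2_31, aT2_31, aT1_31, nnT0_31, nnT1_31, nnT2_31, res11, res12, res13, nnN11_31, nnN12_31, nnN13_31, hlow0_31, hlow1_31, hB1, hC1, hlow2_31, res11, nnM11_31, hlow3_31, res21, nnM21_31, dF31, hD0, dL0, dL1, dL2, dL3, dL4]
  ----------------------------------------------------------------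
  -- level (4, 0)
  ----------------------------------------------------------------
  have hLev40 := angular_level_estimate 4 (r := 8 - gammaExp α) hr0_4 hr1_4 hWc hW0 (regχj 4 0 (by norm_num)) (hsj 0) (hposj 0) (hΨj 0 (by norm_num))
  try simp only [Nat.reduceAdd, Nat.reduceMul, Nat.reducePow, Nat.cast_one, Nat.cast_ofNat, Finset.sum_range_succ, Finset.sum_range_zero, zero_add, Function.iterate_zero, id_eq, iterate_dθ_one, iterate_dθ_two] at hLev40
  have hDat40 := angular_data_bound α 4 0 hr0_4 hWc hW0 (regχd 4 0 (by norm_num)) hs hpos hΨ hgF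
  try simp only [Nat.reduceAdd, Nat.reduceMul, Nat.reducePow, Nat.cast_one, Nat.cast_ofNat, Finset.sum_range_succ, Finset.sum_range_zero, zero_add, Function.iterate_zero, id_eq, iterate_dθ_one, iterate_dθ_two] at hDat40
  have hT0_40 := integral_weight_rpow_mono hWc hW0 (cΨ 4 0 (by norm_num)) (sΨ 4 0) (pΨ 4 0) (r := 4 - gammaExp α) (r' := 8 - gammaExp α) hr0_2 (by linarith)
  try simp only [Nat.reduceAdd, Nat.reduceMul, Nat.reducePow, Nat.cast_one, Nat.cast_ofNat, Finset.sum_range_succ, Finset.sum_range_zero, zero_add, Function.iterate_zero, id_eq, iterate_dθ_one, iterate_dθ_two] at hT0_40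
  have nnT0_40 : 0 ≤ ∫ p in strip, radialWeight p.1 ^ 2 * (dθ^[4] Ψ) p.1 p.2 ^ 2 * Real.sin (2 * p.2) ^ (8 - gammaExp α) :=
    setIntegral_nonneg measurableSet_strip fun p hp => strip_integrand_nonneg hp _ _
  have hT1_40 := integral_weight_rpow_mono hWc hW0 (cΨ 4 1 (by norm_num)) (sΨ 4 1) (pΨ 4 1) (r := 4 - gammaExp α) (r' := 8 - gammaExp α) hr0_2 (by linarith)
  try simp only [Nat.reduceAdd, Nat.reduceMul, Nat.reducePow, Nat.cast_one, Nat.cast_ofNat, Finset.sum_range_succ, Finset.sum_range_zero, zero_add, Function.iterate_zero, id_eq, iterate_dθ_one, iterate_dθ_two] at hT1_40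
  have nnT1_40 : 0 ≤ ∫ p in strip, radialWeight p.1 ^ 2 * (dθ^[4] (Dz^[1] Ψ)) p.1 p.2 ^ 2 * Real.sin (2 * p.2) ^ (8 - gammaExp α) :=
    setIntegral_nonneg measurableSet_strip fun p hp => strip_integrand_nonneg hp _ _
  have hT2_40 := integral_weight_rpow_mono hWc hW0 (cΨ 4 2 (by norm_num)) (sΨ 4 2) (pΨ 4 2) (r := 4 - gammaExp α) (r' := 8 - gammaExp α) hr0_2 (by linarith)
  try simp only [Nat.reduceAdd, Nat.reduceMul, Nat.reducePow, Nat.cast_one, Nat.cast_ofNat, Finset.sum_range_succ, Finset.sum_range_zero, zero_add, Function.iterate_zero, id_eq, iterate_dθ_one, iterate_dθ_two] at hT2_40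
  have nnT2_40 : 0 ≤ ∫ p in strip, radialWeight p.1 ^ 2 * (dθ^[4] (Dz^[2] Ψ)) p.1 p.2 ^ 2 * Real.sin (2 * p.2) ^ (8 - gammaExp α) :=
    setIntegral_nonneg measurableSet_strip fun p hp => strip_integrand_nonneg hp _ _
  have aT2_40 : α ^ 4 * (∫ p in strip, radialWeight p.1 ^ 2 * (dθ^[4] (Dz^[2] Ψ)) p.1 p.2 ^ 2 * Real.sin (2 * p.2) ^ (8 - gammaExp α)) ≤
      1 * ∫ p in strip, radialWeight p.1 ^ 2 * (dθ^[4] (Dz^[2] Ψ)) p.1 p.2 ^ 2 * Real.sin (2 * p.2) ^ (8 - gammaExp α) := mul_le_mul_of_nonneg_right hα4' nnT2_40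
  have aT1_40 : α ^ 2 * (∫ p in strip, radialWeight p.1 ^ 2 * (dθ^[4] (Dz^[1] Ψ)) p.1 p.2 ^ 2 * Real.sin (2 * p.2) ^ (8 - gammaExp α)) ≤
      1 * ∫ p in strip, radialWeight p.1 ^ 2 * (dθ^[4] (Dz^[1] Ψ)) p.1 p.2 ^ 2 * Real.sin (2 * p.2) ^ (8 - gammaExp α) := mul_le_mul_of_nonneg_right hα2 nnT1_40
  have nnN20_40 : 0 ≤ (∫ p in strip, radialWeight p.1 ^ 2 * (dθ^[3] χ) p.1 p.2 ^ 2 * Real.sin (2 * p.2) ^ (4 - gammaExp α)) := setIntegral_nonneg measurableSet_strip fun p hp => strip_integrand_nonneg hp _ _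
  have nnN21_40 : 0 ≤ (∫ p in strip, radialWeight p.1 ^ 2 * (dθ^[3] (Dz^[1] χ)) p.1 p.2 ^ 2 * Real.sin (2 * p.2) ^ (4 - gammaExp α)) := setIntegral_nonneg measurableSet_strip fun p hp => strip_integrand_nonneg hp _ _
  have nnN22_40 : 0 ≤ (∫ p in strip, radialWeight p.1 ^ 2 * (dθ^[3] (Dz^[2] χ)) p.1 p.2 ^ 2 * Real.sin (2 * p.2) ^ (4 - gammaExp α)) := setIntegral_nonneg measurableSet_strip fun p hp => strip_integrand_nonneg hp _ _
  have hlow0_40 := integral_weight_rpow_le_singular hWc hW0 (cχ 0 0 (by norm_num)) (sχ 0 0) (pχ 0 0) hr0_4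
  have hlow1_40 := integral_weight_rpow_le_singular hWc hW0 (cχ 1 0 (by norm_num)) (sχ 1 0) (pχ 1 0) hr0_4
  try simp only [Nat.reduceAdd, Nat.reduceMul, Nat.reducePow, Nat.cast_one, Nat.cast_ofNat, Finset.sum_range_succ, Finset.sum_range_zero, zero_add, Function.iterate_zero, id_eq, iterate_dθ_one, iterate_dθ_two] at hlow0_40 hlow1_40
  have hlow2_40 := integral_weight_rpow_mono hWc hW0 (cχ 2 0 (by norm_num)) (sχ 2 0) (pχ 2 0) (r := 2 - gammaExp α) (r' := 8 - gammaExp α) hr0_1 (by linarith)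
  try simp only [Nat.reduceAdd, Nat.reduceMul, Nat.reducePow, Nat.cast_one, Nat.cast_ofNat, Finset.sum_range_succ, Finset.sum_range_zero, zero_add, Function.iterate_zero, id_eq, iterate_dθ_one, iterate_dθ_two] at hlow2_40
  have nnM10_40 : 0 ≤ (∫ p in strip, radialWeight p.1 ^ 2 * (dθ^[3] Ψ) p.1 p.2 ^ 2 * Real.sin (2 * p.2) ^ (2 - gammaExp α)) := setIntegral_nonneg measurableSet_strip fun p hp => strip_integrand_nonneg hp _ _
  have hlow3_40 := integral_weight_rpow_mono hWc hW0 (cχ 3 0 (by norm_num)) (sχ 3 0) (pχ 3 0) (r := 4 - gammaExp α) (r' := 8 - gammaExp α) hr0_2 (by linarith)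
  try simp only [Nat.reduceAdd, Nat.reduceMul, Nat.reducePow, Nat.cast_one, Nat.cast_ofNat, Finset.sum_range_succ, Finset.sum_range_zero, zero_add, Function.iterate_zero, id_eq, iterate_dθ_one, iterate_dθ_two] at hlow3_40
  have nnM20_40 : 0 ≤ (∫ p in strip, radialWeight p.1 ^ 2 * (dθ^[4] Ψ) p.1 p.2 ^ 2 * Real.sin (2 * p.2) ^ (4 - gammaExp α)) := setIntegral_nonneg measurableSet_strip fun p hp => strip_integrand_nonneg hp _ _
  have hlow4_40 := integral_weight_rpow_mono hWc hW0 (cχ 4 0 (by norm_num)) (sχ 4 0) (pχ 4 0) (r := 6 - gammaExp α) (r' := 8 - gammaExp α) hr0_3 (by linarith)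
  try simp only [Nat.reduceAdd, Nat.reduceMul, Nat.reducePow, Nat.cast_one, Nat.cast_ofNat, Finset.sum_range_succ, Finset.sum_range_zero, zero_add, Function.iterate_zero, id_eq, iterate_dθ_one, iterate_dθ_two] at hlow4_40
  have nnM30_40 : 0 ≤ (∫ p in strip, radialWeight p.1 ^ 2 * (dθ^[5] Ψ) p.1 p.2 ^ 2 * Real.sin (2 * p.2) ^ (6 - gammaExp α)) := setIntegral_nonneg measurableSet_strip fun p hp => strip_integrand_nonneg hp _ _
  have res40 : (∫ p in strip, radialWeight p.1 ^ 2 * (dθ^[6] Ψ) p.1 p.2 ^ 2 * Real.sin (2 * p.2) ^ (8 - gammaExp α)) +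
      (∫ p in strip, radialWeight p.1 ^ 2 * (dθ^[5] χ) p.1 p.2 ^ 2 * Real.sin (2 * p.2) ^ (8 - gammaExp α)) ≤
      70000000000000000000000 * D := by
    linarith only [hLev40, hDat40, hT0_40, hT1_40, hT2_40, aT2_40, aT1_40, nnT0_40, nnT1_40, nnT2_40, res20, res21, res22, nnN20_40, nnN21_40, nnN22_40, hlow0_40, hlow1_40, hB0, hC0, hlow2_40, res10, nnM10_40, hlow3_40, res20, nnM20_40, hlow4_40, res30, nnM30_40, dF40, hD0, dL0, dL1, dL2, dL3, dL4]
  exact ⟨res10, res11, res12, res13, res20, res21, res22, res30, res31, res40⟩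

end Elgindi

end Literature.Analysis.FluidPDE
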